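import Literature.Topology.FourManifolds.PlanarArch
import Mathlib.Analysis.SpecialFunctions.Trigonometric.Inverse
import Mathlib.Analysis.SpecialFunctions.Trigonometric.Deriv
import Mathlib.Analysis.SpecialFunctions.Sqrt
import HarnessLib

/-!
# The unknot is a unit for the connected sum, II: planar profiles

Topic `Literature/Topology/FourManifolds`; second file of the discharge of
`Literature.Topology.FourManifolds.Knot.exists_isConnectedSum_unknot_isIsotopic` (`BandSum.lean`;
Rolfsen (1976), §2.G). Pure real analysis in the coordinate plane `(s, d)` of the vertical plane
through the flat arc (`s` = tangent coordinate, `d` = depth below the arc), at a scale `L > 0`: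

* `BandSumUnit.sp x₀` — a smooth non-decreasing "positive part": `sp x₀ x = 0` for `x ≤ 0`,
  `= x` for `x ≥ x₀`; `spFam x₀ τ = (1 - τ) id + τ sp x₀`.
* `BandSumUnit.dloop L τ φ = (L cos φ, L + spFam (L/8) τ (L/2 - L sin φ))` — for `τ = 0` the round
  circle of radius `L` centred at depth `3L/2`, for `τ = 1` the **D-loop**: that circle with its
  top cap (where `sin φ ≥ 1/2`) flattened onto the chord at depth `L`; jointly smooth, each stage a
  regular closed curve injective modulo `2π` (`dloop_eq_dloop_iff`, `deriv_dloop_ne_zero`).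
* the **mushroom profiles** `A L` (abscissa) and `Fst L` (final depth), `Ftil L` (an auxiliary
  strictly unimodal depth) on the parameter interval `|u| ≤ 3L/4` of the arc, and the three-stage
  family `BandSumUnit.mush L τ u` (`τ ∈ [0, 1]`): vertical growth, horizontal fold, flattening of
  the corners. `mush L 0 u = (u, 0)`, `mush L τ u = (u, 0)` for `|u| ≥ 3L/4`, each stage is
  injective and regular (`mush_injective`, `deriv_mush_ne_zero`), and the final curve `mush L 1`
  runs from `(-3L/4, 0)` inside the band square to the corner `(-3L/4, L)` and then along the
  D-loop `dloop L 1 ∘ ang L` the long way round to the opposite corner and back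
  (`mush_one_eq_dloop`).

These are the planar data of the band sum `K # O` with a small unknot `O` (the D-loop) along the
band `[0, L] × [-3L/4·, ·]` hanging below the flat arc, and of the isotopies `O_round ≃ O`,
`K ≃ K # O` realised in the sequel files by smooth families of simple closed curves.

## References

* D. Rolfsen, *Knots and Links* (1976), §2.G. [Rolfsen1976]
* R. H. Crowell, R. H. Fox, *Introduction to Knot Theory* (1963), Ch. I §2 (differentiable knots as
  regular simple closed curves; local modifications). [CrowellFox1963]

## Design notes

All statements are `[folklore]`; no named facts, no `sorry`. `𝔼 n` is local notation. The angle
parametrisation `ang L u = 3π/2 + k u` (`k = 4 (3π/2 - φ_L)/L`, `cos φ_L = -3/4`) makes the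
abscissa odd and the depth even in `u`, so that the right half of every curve is the mirror image
of the left half.
-/

open scoped ContDiff Topology Real
open Function Set Real

noncomputable section

namespace Literature.Topology.FourManifolds

/-- Local notation: `𝔼 n` is the model Euclidean space `EuclideanSpace ℝ (Fin n)`. -/
local notation "𝔼 " n:arg => EuclideanSpace ℝ (Fin n)

namespace BandSumUnit

/-! ### A smooth positive part -/

/-- **Smooth positive part** with transition width `x₀`: `sp x₀ x = x · smoothStep 0 x₀ x`, equal to
`0` for `x ≤ 0` and to `x` for `x ≥ x₀`. [folklore] -/
def sp (x₀ x : ℝ) : ℝ := x * smoothStep 0 x₀ x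

variable {x₀ : ℝ}

/-- `sp` vanishes on `(-∞, 0]`. [folklore] -/
theorem sp_of_nonpos (hx₀ : 0 < x₀) {x : ℝ} (hx : x ≤ 0) : sp x₀ x = 0 := by
  rw [sp, smoothStep_of_le hx₀ hx, mul_zero]

/-- `sp` is the identity on `[x₀, ∞)`. [folklore] -/
theorem sp_of_ge (hx₀ : 0 < x₀) {x : ℝ} (hx : x₀ ≤ x) : sp x₀ x = x := by
  rw [sp, smoothStep_of_ge hx₀ hx, mul_one]

/-- `sp` is nonnegative. [folklore] -/
theorem sp_nonneg (hx₀ : 0 < x₀) (x : ℝ) : 0 ≤ sp x₀ x := by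
  by_cases hx : x ≤ 0
  · rw [sp_of_nonpos hx₀ hx]
  · exact mul_nonneg (le_of_not_ge hx) (smoothStep_mem_Icc _ _ _).1

/-- `sp` is positive on `(0, ∞)`. [folklore] -/
theorem sp_pos (hx₀ : 0 < x₀) {x : ℝ} (hx : 0 < x) : 0 < sp x₀ x := by
  rw [sp]
  refine mul_pos hx ?_
  by_cases h : x < x₀
  · exact (smoothStep_mem_Ioo hx₀ ⟨hx, h⟩).1
  · rw [smoothStep_of_ge hx₀ (le_of_not_gt h)]; exact one_pos

/-- `sp x = 0 ↔ x ≤ 0`. [folklore] -/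
theorem sp_eq_zero_iff (hx₀ : 0 < x₀) {x : ℝ} : sp x₀ x = 0 ↔ x ≤ 0 :=
  ⟨fun h ↦ by by_contra h'; exact (sp_pos hx₀ (lt_of_not_ge h')).ne' h, sp_of_nonpos hx₀⟩

/-- `sp x ≤ x` for `x ≥ 0`. [folklore] -/
theorem sp_le_self (x₀ : ℝ) {x : ℝ} (hx : 0 ≤ x) : sp x₀ x ≤ x :=
  mul_le_of_le_one_right hx (smoothStep_mem_Icc _ _ _).2

/-- `sp` is `C^∞`. [folklore] -/
theorem contDiff_sp (x₀ : ℝ) : ContDiff ℝ ∞ (sp x₀) := contDiff_id.mul (contDiff_smoothStep _ _)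

/-- `sp` is differentiable. [folklore] -/
theorem differentiable_sp (x₀ : ℝ) : Differentiable ℝ (sp x₀) :=
  (contDiff_sp x₀).differentiable (by simp)

/-- The derivative of `sp`. [folklore] -/
theorem hasDerivAt_sp (x₀ x : ℝ) :
    HasDerivAt (sp x₀) (smoothStep 0 x₀ x + x * deriv (smoothStep 0 x₀) x) x := by
  show HasDerivAt (fun y ↦ y * smoothStep 0 x₀ y) _ x
  have h := (hasDerivAt_id' x).fun_mul ((differentiable_smoothStep 0 x₀ x).hasDerivAt)
  simpa using h

/-- The derivative of `sp` is nonnegative. [folklore] -/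
theorem deriv_sp_nonneg (hx₀ : 0 < x₀) (x : ℝ) : 0 ≤ deriv (sp x₀) x := by
  rw [(hasDerivAt_sp x₀ x).deriv]
  by_cases hx : x ≤ 0
  · rw [smoothStep_of_le hx₀ hx]
    have : deriv (smoothStep 0 x₀) x = 0 := by
      rcases lt_or_eq_of_le hx with h | h
      · exact deriv_smoothStep_of_lt hx₀ h
      · rw [h]; exact deriv_smoothStep_left 0 x₀
    rw [this]; simp
  · exact add_nonneg (smoothStep_mem_Icc _ _ _).1
      (mul_nonneg (le_of_not_ge hx) (deriv_smoothStep_nonneg hx₀ x))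

/-- The derivative of `sp` is positive on `(0, ∞)`. [folklore] -/
theorem deriv_sp_pos (hx₀ : 0 < x₀) {x : ℝ} (hx : 0 < x) : 0 < deriv (sp x₀) x := by
  rw [(hasDerivAt_sp x₀ x).deriv]
  have h1 : 0 < smoothStep 0 x₀ x := by
    by_cases h : x < x₀
    · exact (smoothStep_mem_Ioo hx₀ ⟨hx, h⟩).1
    · rw [smoothStep_of_ge hx₀ (le_of_not_gt h)]; exact one_pos
  exact add_pos_of_pos_of_nonneg h1 (mul_nonneg hx.le (deriv_smoothStep_nonneg hx₀ x))

/-- The derivative of `sp` is `1` beyond `x₀`. [folklore] -/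
theorem deriv_sp_of_gt (hx₀ : 0 < x₀) {x : ℝ} (hx : x₀ < x) : deriv (sp x₀) x = 1 := by
  rw [(hasDerivAt_sp x₀ x).deriv, smoothStep_of_ge hx₀ hx.le, deriv_smoothStep_of_gt hx₀ hx]
  simp

/-- `sp` is monotone. [folklore] -/
theorem monotone_sp (hx₀ : 0 < x₀) : Monotone (sp x₀) :=
  monotone_of_deriv_nonneg (differentiable_sp x₀) (deriv_sp_nonneg hx₀)

/-- `sp` is strictly increasing on `[0, ∞)`. [folklore] -/
theorem strictMonoOn_sp (hx₀ : 0 < x₀) : StrictMonoOn (sp x₀) (Ici 0) :=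
  strictMonoOn_of_deriv_pos (convex_Ici 0) (contDiff_sp x₀).continuous.continuousOn
    fun x hx ↦ deriv_sp_pos hx₀ (by rwa [interior_Ici] at hx)

/-- `sp` takes equal values only at equal points or at two nonpositive points. [folklore] -/
theorem sp_eq_sp_iff (hx₀ : 0 < x₀) {x y : ℝ} :
    sp x₀ x = sp x₀ y ↔ x = y ∨ (x ≤ 0 ∧ y ≤ 0) := by
  constructor
  · intro h
    by_cases hx : x ≤ 0
    · have : sp x₀ y = 0 := by rw [← h, sp_of_nonpos hx₀ hx]
      exact Or.inr ⟨hx, (sp_eq_zero_iff hx₀).1 this⟩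
    · by_cases hy : y ≤ 0
      · have : sp x₀ x = 0 := by rw [h, sp_of_nonpos hx₀ hy]
        exact absurd ((sp_eq_zero_iff hx₀).1 this) hx
      · exact Or.inl ((strictMonoOn_sp hx₀).injOn (le_of_not_ge hx) (le_of_not_ge hy) h)
  · rintro (rfl | ⟨hx, hy⟩)
    · rfl
    · rw [sp_of_nonpos hx₀ hx, sp_of_nonpos hx₀ hy]

/-- **The family** `spFam x₀ τ x = (1 - τ) x + τ sp x₀ x` joining the identity (`τ = 0`) to `sp`
(`τ = 1`). [folklore] -/
def spFam (x₀ τ x : ℝ) : ℝ := (1 - τ) * x + τ * sp x₀ x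

/-- `spFam` at `τ = 0` is the identity. [folklore] -/
@[simp] theorem spFam_zero (x₀ x : ℝ) : spFam x₀ 0 x = x := by simp [spFam]

/-- `spFam` at `τ = 1` is `sp`. [folklore] -/
@[simp] theorem spFam_one (x₀ x : ℝ) : spFam x₀ 1 x = sp x₀ x := by simp [spFam]

/-- `spFam` is the identity beyond `x₀`, for every `τ`. [folklore] -/
theorem spFam_of_ge (hx₀ : 0 < x₀) (τ : ℝ) {x : ℝ} (hx : x₀ ≤ x) : spFam x₀ τ x = x := by
  rw [spFam, sp_of_ge hx₀ hx]; ring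

/-- `spFam` is jointly `C^∞`. [folklore] -/
theorem contDiff_spFam (x₀ : ℝ) : ContDiff ℝ ∞ fun p : ℝ × ℝ ↦ spFam x₀ p.1 p.2 := by
  unfold spFam
  exact ((contDiff_const.sub contDiff_fst).mul contDiff_snd).add
    (contDiff_fst.mul ((contDiff_sp x₀).comp contDiff_snd))

/-- The derivative of a stage of `spFam`. [folklore] -/
theorem hasDerivAt_spFam (x₀ τ x : ℝ) :
    HasDerivAt (spFam x₀ τ) ((1 - τ) + τ * deriv (sp x₀) x) x := by
  show HasDerivAt (fun y ↦ (1 - τ) * y + τ * sp x₀ y) _ x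
  have h1 : HasDerivAt (fun y ↦ (1 - τ) * y) (1 - τ) x := by
    simpa using (hasDerivAt_id' x).const_mul (1 - τ)
  have h2 : HasDerivAt (fun y ↦ τ * sp x₀ y) (τ * deriv (sp x₀) x) x :=
    ((differentiable_sp x₀ x).hasDerivAt).const_mul τ
  exact h1.fun_add h2

/-- For `τ ∈ [0, 1]` the derivative of `spFam x₀ τ` is nonnegative. [folklore] -/
theorem deriv_spFam_nonneg (hx₀ : 0 < x₀) {τ : ℝ} (hτ : τ ∈ Icc (0 : ℝ) 1) (x : ℝ) :
    0 ≤ deriv (spFam x₀ τ) x := by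
  rw [(hasDerivAt_spFam x₀ τ x).deriv]
  exact add_nonneg (by linarith [hτ.2]) (mul_nonneg hτ.1 (deriv_sp_nonneg hx₀ x))

/-- For `τ ∈ [0, 1)` the derivative of `spFam x₀ τ` is positive. [folklore] -/
theorem deriv_spFam_pos_of_lt (hx₀ : 0 < x₀) {τ : ℝ} (hτ : τ ∈ Ico (0 : ℝ) 1) (x : ℝ) :
    0 < deriv (spFam x₀ τ) x := by
  rw [(hasDerivAt_spFam x₀ τ x).deriv]
  exact add_pos_of_pos_of_nonneg (by linarith [hτ.2]) (mul_nonneg hτ.1 (deriv_sp_nonneg hx₀ x))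

/-- For `τ ∈ [0, 1]` the derivative of `spFam x₀ τ` is positive on `(0, ∞)`. [folklore] -/
theorem deriv_spFam_pos (hx₀ : 0 < x₀) {τ : ℝ} (hτ : τ ∈ Icc (0 : ℝ) 1) {x : ℝ} (hx : 0 < x) :
    0 < deriv (spFam x₀ τ) x := by
  rcases eq_or_lt_of_le hτ.2 with h | h
  · rw [(hasDerivAt_spFam x₀ τ x).deriv, h]; simpa using deriv_sp_pos hx₀ hx
  · exact deriv_spFam_pos_of_lt hx₀ ⟨hτ.1, h⟩ x

/-- Beyond `x₀` the derivative of `spFam x₀ τ` is `1`. [folklore] -/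
theorem deriv_spFam_of_gt (hx₀ : 0 < x₀) (τ : ℝ) {x : ℝ} (hx : x₀ < x) :
    deriv (spFam x₀ τ) x = 1 := by
  rw [(hasDerivAt_spFam x₀ τ x).deriv, deriv_sp_of_gt hx₀ hx]; ring

/-- Stages of `spFam` are differentiable. [folklore] -/
theorem differentiable_spFam (x₀ τ : ℝ) : Differentiable ℝ (spFam x₀ τ) :=
  fun x ↦ (hasDerivAt_spFam x₀ τ x).differentiableAt

/-- For `τ ∈ [0, 1]`, `spFam x₀ τ` is monotone. [folklore] -/
theorem monotone_spFam (hx₀ : 0 < x₀) {τ : ℝ} (hτ : τ ∈ Icc (0 : ℝ) 1) : Monotone (spFam x₀ τ) :=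
  monotone_of_deriv_nonneg (differentiable_spFam x₀ τ) (deriv_spFam_nonneg hx₀ hτ)

/-- **Injectivity pattern of `spFam`**: for `τ ∈ [0, 1]`, equal values are taken only at equal
points or at two nonpositive points. [folklore] -/
theorem spFam_eq_spFam_imp (hx₀ : 0 < x₀) {τ : ℝ} (hτ : τ ∈ Icc (0 : ℝ) 1) {x y : ℝ}
    (h : spFam x₀ τ x = spFam x₀ τ y) : x = y ∨ (x ≤ 0 ∧ y ≤ 0) := by
  rcases eq_or_lt_of_le hτ.2 with h1 | h1
  · rw [h1, spFam_one, spFam_one] at h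
    exact (sp_eq_sp_iff hx₀).1 h
  · left
    exact (strictMono_of_deriv_pos (deriv_spFam_pos_of_lt hx₀ ⟨hτ.1, h1⟩)).injective h


/-! ### Planar curves written with `pt2` -/

section Pt2

variable {X : Type*} [NormedAddCommGroup X] [NormedSpace ℝ X]

/-- A planar map given by two `C^n` coordinate functions is `C^n`. [folklore] -/
theorem contDiff_pt2 {n : WithTop ℕ∞} {f g : X → ℝ} (hf : ContDiff ℝ n f) (hg : ContDiff ℝ n g) :
    ContDiff ℝ n fun x ↦ pt2 (f x) (g x) := by
  rw [contDiff_euclidean]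
  intro i
  fin_cases i
  · exact hf
  · exact hg

/-- `pt2` is injective in both coordinates. [folklore] -/
theorem pt2_eq_pt2_iff {a b a' b' : ℝ} : pt2 a b = pt2 a' b' ↔ a = a' ∧ b = b' := by
  constructor
  · intro h
    exact ⟨by simpa using congrArg (fun q : 𝔼 2 ↦ q 0) h, by simpa using congrArg (fun q : 𝔼 2 ↦ q 1) h⟩
  · rintro ⟨rfl, rfl⟩; rfl

/-- `pt2 a b = 0 ↔ a = 0 ∧ b = 0`. [folklore] -/
theorem pt2_eq_zero_iff {a b : ℝ} : pt2 a b = 0 ↔ a = 0 ∧ b = 0 := by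
  have : (0 : 𝔼 2) = pt2 0 0 := by ext i; fin_cases i <;> rfl
  rw [this, pt2_eq_pt2_iff]

/-- Every point of the plane is a `pt2`. [folklore] -/
theorem pt2_eta (q : 𝔼 2) : pt2 (q 0) (q 1) = q := by
  ext i; fin_cases i <;> rfl

end Pt2

/-! ### Convex combinations -/

/-- A convex combination of two numbers below `m` is below `m`. [folklore] -/
theorem combo_lt_of_lt {a b t m : ℝ} (ht : t ∈ Icc (0 : ℝ) 1) (ha : a < m) (hb : b < m) :
    (1 - t) * a + t * b < m := by
  have hd := lt_min (sub_pos.2 ha) (sub_pos.2 hb)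
  nlinarith [mul_nonneg (sub_nonneg.2 ht.2) (sub_nonneg.2 (min_le_left (m - a) (m - b))),
    mul_nonneg ht.1 (sub_nonneg.2 (min_le_right (m - a) (m - b)))]

/-- A convex combination of two numbers above `m` is above `m`. [folklore] -/
theorem lt_combo_of_lt {a b t m : ℝ} (ht : t ∈ Icc (0 : ℝ) 1) (ha : m < a) (hb : m < b) :
    m < (1 - t) * a + t * b := by
  have := combo_lt_of_lt (a := -a) (b := -b) (m := -m) ht (by linarith) (by linarith)
  linarith

/-- A convex combination of two numbers in `[lo, hi]` is in `[lo, hi]`. [folklore] -/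
theorem combo_mem_Icc {a b t lo hi : ℝ} (ht : t ∈ Icc (0 : ℝ) 1) (ha : a ∈ Icc lo hi)
    (hb : b ∈ Icc lo hi) : (1 - t) * a + t * b ∈ Icc lo hi := by
  constructor
  · nlinarith [mul_nonneg (sub_nonneg.2 ht.2) (sub_nonneg.2 ha.1), mul_nonneg ht.1 (sub_nonneg.2 hb.1)]
  · nlinarith [mul_nonneg (sub_nonneg.2 ht.2) (sub_nonneg.2 ha.2), mul_nonneg ht.1 (sub_nonneg.2 hb.2)]

/-! ### Angles with equal cosine and sine -/

/-- Two reals with the same cosine and sine differ by an integer multiple of `2π`. [folklore] -/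
theorem exists_eq_add_of_cos_eq_of_sin_eq {s t : ℝ} (hc : cos s = cos t) (hs : sin s = sin t) :
    ∃ k : ℤ, s = t + k * (2 * π) := by
  obtain ⟨k, hk⟩ := Real.Angle.angle_eq_iff_two_pi_dvd_sub.1 (Real.Angle.cos_sin_inj hc hs)
  exact ⟨k, by linarith⟩

/-- Two reals with the same cosine and both with sine `> 0`... more generally with sines of the
same strict sign pattern `0 < sin`, differ by a multiple of `2π`. [folklore] -/
theorem exists_eq_add_of_cos_eq_of_sin_pos {s t : ℝ} (hc : cos s = cos t) (hs : 0 < sin s)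
    (ht : 0 < sin t) : ∃ k : ℤ, s = t + k * (2 * π) := by
  refine exists_eq_add_of_cos_eq_of_sin_eq hc ?_
  have h1 : sin s ^ 2 = sin t ^ 2 := by
    have e1 := sin_sq_add_cos_sq s
    have e2 := sin_sq_add_cos_sq t
    rw [hc] at e1
    linarith
  have h2 : (sin s - sin t) * (sin s + sin t) = 0 := by ring_nf; linarith
  rcases mul_eq_zero.1 h2 with h | h
  · linarith
  · linarith

/-! ### The D-loop and its round relatives -/

section DLoop

variable (L : ℝ)

/-- **The D-loop family** at scale `L`: `dloop L τ φ = (L cos φ, L + spFam (L/8) τ (L/2 - L sin φ))`.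
For `τ = 0` this is the round circle of radius `L` centred at `(0, 3L/2)` (depth axis pointing
down), for `τ = 1` the **D-loop**: the part of that circle where `sin φ ≥ 1/2` is flattened onto the
chord at depth `L`. [folklore] -/
def dloop (τ φ : ℝ) : 𝔼 2 := pt2 (L * cos φ) (L + spFam (L / 8) τ (L / 2 - L * sin φ))

/-- Abscissa of the D-loop family. [folklore] -/
@[simp] theorem dloop_apply_zero (τ φ : ℝ) : dloop L τ φ 0 = L * cos φ := rfl

/-- Depth of the D-loop family. [folklore] -/
@[simp] theorem dloop_apply_one (τ φ : ℝ) :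
    dloop L τ φ 1 = L + spFam (L / 8) τ (L / 2 - L * sin φ) := rfl

/-- The round stage `τ = 0`: the circle of radius `L` centred at depth `3L/2`. [folklore] -/
theorem dloop_zero (φ : ℝ) : dloop L 0 φ = pt2 (L * cos φ) (3 * L / 2 - L * sin φ) := by
  rw [dloop, spFam_zero, pt2_eq_pt2_iff]; constructor <;> ring

/-- The D-loop family is `2π`-periodic in the angle. [folklore] -/
theorem dloop_add_two_pi (τ φ : ℝ) : dloop L τ (φ + 2 * π) = dloop L τ φ := by
  rw [dloop, dloop, cos_add_two_pi, sin_add_two_pi]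

/-- The D-loop family is periodic. [folklore] -/
theorem periodic_dloop (τ : ℝ) : Periodic (dloop L τ) (2 * π) := dloop_add_two_pi L τ

/-- Integer translates of the period. [folklore] -/
theorem dloop_add_int_mul (τ φ : ℝ) (k : ℤ) : dloop L τ (φ + k * (2 * π)) = dloop L τ φ :=
  (periodic_dloop L τ).int_mul k φ

/-- The D-loop family is jointly `C^∞`. [folklore] -/
theorem contDiff_dloop : ContDiff ℝ ∞ fun p : ℝ × ℝ ↦ dloop L p.1 p.2 := by
  unfold dloop
  refine contDiff_pt2 (contDiff_const.mul (contDiff_cos.comp contDiff_snd)) (contDiff_const.add ?_)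
  exact (contDiff_spFam (L / 8)).comp
    (contDiff_fst.prodMk (contDiff_const.sub (contDiff_const.mul (contDiff_sin.comp contDiff_snd))))

/-- Each stage of the D-loop family is `C^∞`. [folklore] -/
theorem contDiff_dloop_stage (τ : ℝ) : ContDiff ℝ ∞ (dloop L τ) := by
  have : dloop L τ = (fun p : ℝ × ℝ ↦ dloop L p.1 p.2) ∘ fun φ ↦ (τ, φ) := rfl
  rw [this]
  exact (contDiff_dloop L).comp (contDiff_const.prodMk contDiff_id)

variable {L}

/-- **Injectivity modulo the period**: for `L > 0` and `τ ∈ [0, 1]`, `dloop L τ φ = dloop L τ φ'`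
only when `φ' - φ ∈ 2πℤ`. [folklore] -/
theorem dloop_eq_dloop_imp (hL : 0 < L) {τ : ℝ} (hτ : τ ∈ Icc (0 : ℝ) 1) {φ φ' : ℝ}
    (h : dloop L τ φ = dloop L τ φ') : ∃ k : ℤ, φ = φ' + k * (2 * π) := by
  rw [dloop, dloop, pt2_eq_pt2_iff] at h
  obtain ⟨hc, hd⟩ := h
  have hc' : cos φ = cos φ' := by
    have := mul_left_cancel₀ hL.ne' hc; exact this
  have hx₀ : 0 < L / 8 := by positivity
  rcases spFam_eq_spFam_imp hx₀ hτ (add_left_cancel hd) with h1 | ⟨h1, h2⟩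
  · have hs : sin φ = sin φ' := by
      have : L * sin φ = L * sin φ' := by linarith
      exact mul_left_cancel₀ hL.ne' this
    exact exists_eq_add_of_cos_eq_of_sin_eq hc' hs
  · have hs : 0 < sin φ := by nlinarith
    have hs' : 0 < sin φ' := by nlinarith
    exact exists_eq_add_of_cos_eq_of_sin_pos hc' hs hs'

/-- The derivative of a stage of the D-loop family. [folklore] -/
theorem hasDerivAt_dloop (L τ φ : ℝ) :
    HasDerivAt (dloop L τ) (pt2 (-(L * sin φ))
      (deriv (spFam (L / 8) τ) (L / 2 - L * sin φ) * (-(L * cos φ)))) φ := by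
  unfold dloop
  refine hasDerivAt_pt2 ?_ ?_
  · simpa using (hasDerivAt_cos φ).const_mul L
  · have h1 : HasDerivAt (fun φ ↦ L / 2 - L * sin φ) (-(L * cos φ)) φ := by
      simpa using ((hasDerivAt_sin φ).const_mul L).const_sub (L / 2)
    have h2 := ((differentiable_spFam (L / 8) τ) (L / 2 - L * sin φ)).hasDerivAt.comp φ h1
    simpa using h2.const_add L

/-- **Regularity**: for `L > 0` and `τ ∈ [0, 1]` the velocity of `dloop L τ` never vanishes.
[folklore] -/
theorem deriv_dloop_ne_zero (hL : 0 < L) (τ φ : ℝ) : deriv (dloop L τ) φ ≠ 0 := by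
  rw [(hasDerivAt_dloop L τ φ).deriv, Ne, pt2_eq_zero_iff, not_and_or]
  by_cases hs : sin φ = 0
  · right
    have hx₀ : 0 < L / 8 := by positivity
    have harg : L / 8 < L / 2 - L * sin φ := by rw [hs]; linarith
    rw [deriv_spFam_of_gt hx₀ τ harg, one_mul, neg_eq_zero]
    have hc : cos φ ≠ 0 := by
      intro h; have := sin_sq_add_cos_sq φ; rw [hs, h] at this; norm_num at this
    exact mul_ne_zero hL.ne' hc
  · left
    exact neg_ne_zero.2 (mul_ne_zero hL.ne' hs)

/-- **The D-loop lies at depth `≥ L`.** [folklore] -/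
theorem le_dloop_one_apply_one (hL : 0 < L) (φ : ℝ) : L ≤ dloop L 1 φ 1 := by
  rw [dloop_apply_one, spFam_one]
  have := sp_nonneg (by positivity : 0 < L / 8) (L / 2 - L * sin φ)
  linarith

/-- The D-loop is flat at depth `L` exactly where `sin φ ≥ 1/2`. [folklore] -/
theorem dloop_one_apply_one_eq_iff (hL : 0 < L) (φ : ℝ) : dloop L 1 φ 1 = L ↔ 1 / 2 ≤ sin φ := by
  rw [dloop_apply_one, spFam_one, add_eq_left, sp_eq_zero_iff (by positivity : 0 < L / 8)]
  constructor
  · intro h; nlinarith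
  · intro h; nlinarith

/-- The D-loop on its flat top: `dloop L 1 φ = (L cos φ, L)` when `sin φ ≥ 1/2`. [folklore] -/
theorem dloop_one_of_half_le_sin (hL : 0 < L) {φ : ℝ} (h : 1 / 2 ≤ sin φ) :
    dloop L 1 φ = pt2 (L * cos φ) L := by
  rw [← pt2_eta (dloop L 1 φ), dloop_apply_zero, (dloop_one_apply_one_eq_iff hL φ).2 h]

/-- On the lower half (`sin φ ≤ 0`) the D-loop is the round circle:
`dloop L 1 φ = (L cos φ, 3L/2 - L sin φ)`, at depth `≥ 3L/2`. [folklore] -/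
theorem dloop_one_of_sin_nonpos (hL : 0 < L) {φ : ℝ} (h : sin φ ≤ 0) :
    dloop L 1 φ = pt2 (L * cos φ) (3 * L / 2 - L * sin φ) := by
  rw [← pt2_eta (dloop L 1 φ), dloop_apply_zero, dloop_apply_one, spFam_one,
    sp_of_ge (by positivity : 0 < L / 8) (by nlinarith : L / 8 ≤ L / 2 - L * sin φ), pt2_eq_pt2_iff]
  exact ⟨rfl, by ring⟩

/-- The velocity of the D-loop at its top point `φ = π/2` is `(-L, 0)`: it traverses the flat
top in the direction of decreasing abscissa. [folklore] -/
theorem deriv_dloop_one_pi_div_two (L : ℝ) : deriv (dloop L 1) (π / 2) = pt2 (-L) 0 := by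
  rw [(hasDerivAt_dloop L 1 (π / 2)).deriv, sin_pi_div_two, cos_pi_div_two]
  simp

/-- The top point of the D-loop is `(0, L)`. [folklore] -/
theorem dloop_one_pi_div_two (hL : 0 < L) : dloop L 1 (π / 2) = pt2 0 L := by
  rw [dloop_one_of_half_le_sin hL (by rw [sin_pi_div_two]; norm_num), cos_pi_div_two, mul_zero]

end DLoop

/-! ### The corner angle `φ_L` -/

/-- **The corner angle** `φ_L = arccos (-3/4) ∈ (π/2, π)`: the angle of the D-loop at the lower
left corner of the band square. [folklore] -/
def phiL : ℝ := arccos (-3 / 4)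

/-- `cos φ_L = -3/4`. [folklore] -/
@[simp] theorem cos_phiL : cos phiL = -3 / 4 := cos_arccos (by norm_num) (by norm_num)

/-- `sin φ_L = √(7/16)`. [folklore] -/
theorem sin_phiL : sin phiL = √(7 / 16) := by
  rw [phiL, sin_arccos]; norm_num

/-- `1/2 < sin φ_L`. [folklore] -/
theorem one_half_lt_sin_phiL : 1 / 2 < sin phiL := by
  rw [sin_phiL, lt_sqrt (by norm_num)]; norm_num

/-- `0 < sin φ_L`. [folklore] -/
theorem sin_phiL_pos : 0 < sin phiL := lt_trans (by norm_num) one_half_lt_sin_phiL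

/-- `π/2 < φ_L`. [folklore] -/
theorem pi_div_two_lt_phiL : π / 2 < phiL := by
  rw [phiL]; exact lt_of_not_ge fun h ↦ by have := arccos_le_pi_div_two.1 h; norm_num at this

/-- `φ_L < π`. [folklore] -/
theorem phiL_lt_pi : phiL < π := by rw [phiL]; exact arccos_lt_pi.2 (by norm_num)

/-- The excess `Δ = φ_L - π/2 ∈ (0, π/2)`. [folklore] -/
def delta : ℝ := phiL - π / 2

/-- `0 < Δ`. [folklore] -/
theorem delta_pos : 0 < delta := by unfold delta; linarith [pi_div_two_lt_phiL]

/-- `Δ < π/2`. [folklore] -/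
theorem delta_lt : delta < π / 2 := by unfold delta; linarith [phiL_lt_pi]

/-! ### The angle parametrisation of the mushroom -/

section Mush

variable (L : ℝ)

/-- The slope `k = 4 (3π/2 - φ_L) / L` of the angle parametrisation. [folklore] -/
def kAng : ℝ := 4 * (3 * π / 2 - phiL) / L

/-- **The angle parametrisation** `ang L u = 3π/2 + k u`: `ang L 0 = 3π/2` (the bottom of the
D-loop), `ang L (-L/4) = φ_L` (the lower left corner). [folklore] -/
def ang (u : ℝ) : ℝ := 3 * π / 2 + kAng L * u

/-- The inverse of the angle parametrisation. [folklore] -/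
def uAt (φ : ℝ) : ℝ := (φ - 3 * π / 2) / kAng L

variable {L}

/-- `0 < k` for `L > 0`. [folklore] -/
theorem kAng_pos (hL : 0 < L) : 0 < kAng L := by
  unfold kAng
  exact div_pos (mul_pos four_pos (by linarith [phiL_lt_pi, pi_pos])) hL

/-- `ang (uAt φ) = φ`. [folklore] -/
@[simp] theorem ang_uAt (hL : 0 < L) (φ : ℝ) : ang L (uAt L φ) = φ := by
  unfold ang uAt; field_simp [(kAng_pos hL).ne']; ring

/-- `uAt (ang u) = u`. [folklore] -/
@[simp] theorem uAt_ang (hL : 0 < L) (u : ℝ) : uAt L (ang L u) = u := by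
  unfold ang uAt; field_simp [(kAng_pos hL).ne']; ring

/-- `ang` at `0`. [folklore] -/
@[simp] theorem ang_zero (L : ℝ) : ang L 0 = 3 * π / 2 := by simp [ang]

/-- `ang (-L/4) = φ_L`. [folklore] -/
theorem ang_neg_quarter (hL : 0 < L) : ang L (-(L / 4)) = phiL := by
  unfold ang kAng; field_simp; ring

/-- `uAt φ_L = -L/4`. [folklore] -/
theorem uAt_phiL (hL : 0 < L) : uAt L phiL = -(L / 4) := by
  rw [← ang_neg_quarter hL, uAt_ang hL]

/-- `ang (L/4) = 3π - φ_L`. [folklore] -/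
theorem ang_quarter (hL : 0 < L) : ang L (L / 4) = 3 * π - phiL := by
  unfold ang kAng; field_simp; ring

/-- `ang` is strictly increasing. [folklore] -/
theorem ang_lt_ang (hL : 0 < L) {u v : ℝ} : ang L u < ang L v ↔ u < v := by
  unfold ang; constructor
  · intro h; nlinarith [kAng_pos hL]
  · intro h; nlinarith [kAng_pos hL]

/-- `ang` is monotone. [folklore] -/
theorem ang_le_ang (hL : 0 < L) {u v : ℝ} : ang L u ≤ ang L v ↔ u ≤ v := by
  unfold ang; constructor
  · intro h; nlinarith [kAng_pos hL]
  · intro h; nlinarith [kAng_pos hL]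

/-- `uAt` is strictly increasing. [folklore] -/
theorem uAt_lt_uAt (hL : 0 < L) {φ ψ : ℝ} : uAt L φ < uAt L ψ ↔ φ < ψ := by
  rw [← ang_lt_ang hL (u := uAt L φ), ang_uAt hL, ang_uAt hL]

/-- `u < uAt φ ↔ ang u < φ`. [folklore] -/
theorem lt_uAt_iff (hL : 0 < L) {u φ : ℝ} : u < uAt L φ ↔ ang L u < φ := by
  rw [← ang_lt_ang hL (u := u), ang_uAt hL]

/-- `uAt φ < u ↔ φ < ang u`. [folklore] -/
theorem uAt_lt_iff (hL : 0 < L) {u φ : ℝ} : uAt L φ < u ↔ φ < ang L u := by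
  rw [← ang_lt_ang hL (v := u), ang_uAt hL]

/-- `u ≤ uAt φ ↔ ang u ≤ φ`. [folklore] -/
theorem le_uAt_iff (hL : 0 < L) {u φ : ℝ} : u ≤ uAt L φ ↔ ang L u ≤ φ := by
  rw [← ang_le_ang hL (u := u), ang_uAt hL]

/-- `uAt φ ≤ u ↔ φ ≤ ang u`. [folklore] -/
theorem uAt_le_iff (hL : 0 < L) {u φ : ℝ} : uAt L φ ≤ u ↔ φ ≤ ang L u := by
  rw [← ang_le_ang hL (v := u), ang_uAt hL]

/-- `cos (ang u) = sin (k u)` (so the abscissa `L cos (ang u)` is odd in `u`). [folklore] -/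
theorem cos_ang (L u : ℝ) : cos (ang L u) = sin (kAng L * u) := by
  rw [ang, show 3 * π / 2 + kAng L * u = (kAng L * u + π / 2) + π by ring, cos_add_pi,
    cos_add_pi_div_two, neg_neg]

/-- `sin (ang u) = -cos (k u)` (so the depth is even in `u`). [folklore] -/
theorem sin_ang (L u : ℝ) : sin (ang L u) = -cos (kAng L * u) := by
  rw [ang, show 3 * π / 2 + kAng L * u = (kAng L * u + π / 2) + π by ring, sin_add_pi,
    sin_add_pi_div_two]

/-- `cos (ang (-u)) = -cos (ang u)`. [folklore] -/
theorem cos_ang_neg (L u : ℝ) : cos (ang L (-u)) = -cos (ang L u) := by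
  rw [cos_ang, cos_ang, mul_neg, sin_neg]

/-- `sin (ang (-u)) = sin (ang u)`. [folklore] -/
theorem sin_ang_neg (L u : ℝ) : sin (ang L (-u)) = sin (ang L u) := by
  rw [sin_ang, sin_ang, mul_neg, cos_neg]

/-- `ang` is differentiable with derivative `k`. [folklore] -/
theorem hasDerivAt_ang (L u : ℝ) : HasDerivAt (ang L) (kAng L) u := by
  unfold ang; simpa using ((hasDerivAt_id' u).const_mul (kAng L)).const_add (3 * π / 2)

/-- `ang` is `C^∞`. [folklore] -/
theorem contDiff_ang (L : ℝ) : ContDiff ℝ ∞ (ang L) := by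
  unfold ang; exact contDiff_const.add (contDiff_const.mul contDiff_id)

/-! ### The zones -/

/-- Left end of the abscissa blend: `ang ua = π/2 + Δ/4`. [folklore] -/
def ua (L : ℝ) : ℝ := uAt L (π / 2 + delta / 4)

/-- Right end of the abscissa blend: `ang ub = π/2 + Δ/2`. [folklore] -/
def ub (L : ℝ) : ℝ := uAt L (π / 2 + delta / 2)

/-- Start of the depth plateau: `ang u1 = π/2 + 3Δ/4`. [folklore] -/
def u1 (L : ℝ) : ℝ := uAt L (π / 2 + 3 * delta / 4)

/-- The corner parameter `s* = -L/4` (`ang s* = φ_L`). [folklore] -/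
def sStar (L : ℝ) : ℝ := -(L / 4)

/-- `ang ua`. [folklore] -/
@[simp] theorem ang_ua (hL : 0 < L) : ang L (ua L) = π / 2 + delta / 4 := ang_uAt hL _
/-- `ang ub`. [folklore] -/
@[simp] theorem ang_ub (hL : 0 < L) : ang L (ub L) = π / 2 + delta / 2 := ang_uAt hL _
/-- `ang u1`. [folklore] -/
@[simp] theorem ang_u1 (hL : 0 < L) : ang L (u1 L) = π / 2 + 3 * delta / 4 := ang_uAt hL _
/-- `ang s*`. [folklore] -/
@[simp] theorem ang_sStar (hL : 0 < L) : ang L (sStar L) = phiL := ang_neg_quarter hL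

/-- `-3L/4 < ua`. [folklore] -/
theorem neg_three_quarters_lt_ua (hL : 0 < L) : -(3 * L / 4) < ua L := by
  rw [ua, lt_uAt_iff hL, ang]
  have hk : kAng L * -(3 * L / 4) = -3 * (3 * π / 2 - phiL) := by unfold kAng; field_simp
  rw [hk, delta]
  nlinarith [delta_pos, delta_lt, phiL_lt_pi, pi_div_two_lt_phiL]

/-- `ua < ub`. [folklore] -/
theorem ua_lt_ub (hL : 0 < L) : ua L < ub L := by
  rw [ua, ub, uAt_lt_uAt hL]; linarith [delta_pos]

/-- `ub < u1`. [folklore] -/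
theorem ub_lt_u1 (hL : 0 < L) : ub L < u1 L := by
  rw [ub, u1, uAt_lt_uAt hL]; linarith [delta_pos]

/-- `u1 < s*`. [folklore] -/
theorem u1_lt_sStar (hL : 0 < L) : u1 L < sStar L := by
  rw [sStar, ← uAt_phiL hL, u1, uAt_lt_uAt hL, delta]; linarith [delta_pos, pi_div_two_lt_phiL]

/-- `s* < 0`. [folklore] -/
theorem sStar_neg (hL : 0 < L) : sStar L < 0 := by unfold sStar; linarith

/-- `ua < 0`. [folklore] -/
theorem ua_neg (hL : 0 < L) : ua L < 0 :=
  (ua_lt_ub hL).trans ((ub_lt_u1 hL).trans ((u1_lt_sStar hL).trans (sStar_neg hL)))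

/-- `ub < 0`. [folklore] -/
theorem ub_neg (hL : 0 < L) : ub L < 0 :=
  (ub_lt_u1 hL).trans ((u1_lt_sStar hL).trans (sStar_neg hL))

/-- `u1 < 0`. [folklore] -/
theorem u1_neg (hL : 0 < L) : u1 L < 0 := (u1_lt_sStar hL).trans (sStar_neg hL)

/-- `-3L/4 < s*`. [folklore] -/
theorem neg_three_quarters_lt_sStar (hL : 0 < L) : -(3 * L / 4) < sStar L := by
  unfold sStar; linarith

/-- Angles of parameters in `[ua, 0]` lie in `[π/2, 3π/2]`. [folklore] -/
theorem ang_mem_of_mem (hL : 0 < L) {u : ℝ} (hu : u ∈ Icc (ua L) 0) :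
    ang L u ∈ Icc (π / 2) (3 * π / 2) := by
  constructor
  · have := (ang_le_ang hL).2 hu.1; rw [ang_ua hL] at this; linarith [delta_pos]
  · have := (ang_le_ang hL).2 hu.2; rwa [ang_zero] at this

/-- `cos (ang u) ≤ 0` for `u ∈ [ua, 0]`. [folklore] -/
theorem cos_ang_nonpos (hL : 0 < L) {u : ℝ} (hu : u ∈ Icc (ua L) 0) : cos (ang L u) ≤ 0 :=
  cos_nonpos_of_pi_div_two_le_of_le (ang_mem_of_mem hL hu).1 (by linarith [(ang_mem_of_mem hL hu).2])

/-- `cos (ang u) < 0` for `u ∈ (ua, 0)`. [folklore] -/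
theorem cos_ang_neg' (hL : 0 < L) {u : ℝ} (hu : u ∈ Ioo (ua L) 0) : cos (ang L u) < 0 := by
  have h1 : π / 2 < ang L u := by
    have := (ang_lt_ang hL).2 hu.1; rw [ang_ua hL] at this; linarith [delta_pos]
  have h2 : ang L u < 3 * π / 2 := by
    have := (ang_lt_ang hL).2 hu.2; rwa [ang_zero] at this
  exact cos_neg_of_pi_div_two_lt_of_lt h1 (by linarith)

/-- `sin (ang u) > 1/2` for `u ∈ [ua, s*]` (there the angle lies in `[π/2, φ_L]`). [folklore] -/
theorem one_half_lt_sin_ang (hL : 0 < L) {u : ℝ} (hu : u ∈ Icc (ua L) (sStar L)) :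
    1 / 2 < sin (ang L u) := by
  have h1 : π / 2 ≤ ang L u := by
    have := (ang_le_ang hL).2 hu.1; rw [ang_ua hL] at this; linarith [delta_pos]
  have h2 : ang L u ≤ phiL := by
    have := (ang_le_ang hL).2 hu.2; rwa [ang_sStar hL] at this
  -- `sin` is decreasing on `[π/2, π]`: compare through `sin x = sin (π - x)`
  have h3 : sin phiL ≤ sin (ang L u) := by
    rw [← sin_pi_sub phiL, ← sin_pi_sub (ang L u)]
    exact sin_le_sin_of_le_of_le_pi_div_two (by linarith [phiL_lt_pi]) (by linarith) (by linarith)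
  linarith [one_half_lt_sin_phiL]

/-- `cos (ang u) > -3/4` for `u ∈ [ua, s*)` (the angle is `< φ_L`). [folklore] -/
theorem neg_three_quarters_lt_cos_ang (hL : 0 < L) {u : ℝ} (hu : u ∈ Ico (ua L) (sStar L)) :
    -3 / 4 < cos (ang L u) := by
  have h1 : 0 ≤ ang L u := by
    have := (ang_le_ang hL).2 hu.1; rw [ang_ua hL] at this; linarith [delta_pos, pi_pos]
  have h2 : ang L u < phiL := by
    have := (ang_lt_ang hL).2 hu.2; rwa [ang_sStar hL] at this
  rw [← cos_phiL]
  exact cos_lt_cos_of_nonneg_of_le_pi h1 phiL_lt_pi.le h2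

/-! ### The cut-offs and the profiles -/

/-- **The even plateau cut-off** `Ω`: `1` on `[ub, -ub]`, `0` outside `(ua, -ua)`. [folklore] -/
def Ω (L u : ℝ) : ℝ := smoothStep (ua L) (ub L) u * smoothStep (ua L) (ub L) (-u)

/-- **The abscissa profile** `A u = (1 - Ω u) u + Ω u · L cos (ang u)`: the identity near the ends
of the arc, the abscissa of the D-loop in the middle; odd. [folklore] -/
def A (L u : ℝ) : ℝ := (1 - Ω L u) * u + Ω L u * (L * cos (ang L u))

/-- The base depth step `L · smoothStep (-3L/4) u1 u · smoothStep (-3L/4) u1 (-u)` (even, `0` at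
the ends of the arc, `L` on `[u1, -u1]`). [folklore] -/
def Fbase (L u : ℝ) : ℝ := L * (smoothStep (-(3 * L / 4)) (u1 L) u * smoothStep (-(3 * L / 4)) (u1 L) (-u))

/-- The D-loop correction `Ω u · sp (L/8) (L/2 - L sin (ang u))` (even, `0` on `[ua, s*]` and
outside `(ua, -ua)`). [folklore] -/
def spT (L u : ℝ) : ℝ := Ω L u * sp (L / 8) (L / 2 - L * sin (ang L u))

/-- **The final depth profile** `Fst = Fbase + spT`. [folklore] -/
def Fst (L u : ℝ) : ℝ := Fbase L u + spT L u

/-- **The auxiliary depth profile** `Ftil u = L · smoothStep (-3L/4) 0 u · smoothStep (-3L/4) 0 (-u)`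
(even, strictly increasing on `[-3L/4, 0]`). [folklore] -/
def Ftil (L u : ℝ) : ℝ := L * (smoothStep (-(3 * L / 4)) 0 u * smoothStep (-(3 * L / 4)) 0 (-u))

/-- Stage weights: `β₁` rises on `[0, 1/3]`. [folklore] -/
def β₁ (τ : ℝ) : ℝ := smoothStep 0 (1 / 3) τ
/-- Stage weights: `β₂` rises on `[1/3, 2/3]`. [folklore] -/
def β₂ (τ : ℝ) : ℝ := smoothStep (1 / 3) (2 / 3) τ
/-- Stage weights: `β₃` rises on `[2/3, 1]`. [folklore] -/
def β₃ (τ : ℝ) : ℝ := smoothStep (2 / 3) 1 τ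

/-- The abscissa of the mushroom family. [folklore] -/
def absc (L τ u : ℝ) : ℝ := (1 - β₂ τ) * u + β₂ τ * A L u

/-- The depth of the mushroom family. [folklore] -/
def dep (L τ u : ℝ) : ℝ := β₁ τ * ((1 - β₃ τ) * Ftil L u + β₃ τ * Fst L u)

/-- **The mushroom family** `mush L τ u = (absc τ u, dep τ u)`: stage 1 (`τ ∈ [0, 1/3]`) grows the
depth `Ftil` vertically, stage 2 (`τ ∈ [1/3, 2/3]`) folds the abscissa from `u` to `A u`, stage 3
(`τ ∈ [2/3, 1]`) replaces the depth `Ftil` by the final depth `Fst` (flattening the corners onto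
the chord of the D-loop). [folklore] -/
def mush (L τ u : ℝ) : 𝔼 2 := pt2 (absc L τ u) (dep L τ u)

/-! #### The weights -/

/-- `β₁ ∈ [0, 1]`. [folklore] -/
theorem β₁_mem (τ : ℝ) : β₁ τ ∈ Icc (0 : ℝ) 1 := smoothStep_mem_Icc _ _ _
/-- `β₂ ∈ [0, 1]`. [folklore] -/
theorem β₂_mem (τ : ℝ) : β₂ τ ∈ Icc (0 : ℝ) 1 := smoothStep_mem_Icc _ _ _
/-- `β₃ ∈ [0, 1]`. [folklore] -/
theorem β₃_mem (τ : ℝ) : β₃ τ ∈ Icc (0 : ℝ) 1 := smoothStep_mem_Icc _ _ _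

/-- At `τ = 0` all weights vanish. [folklore] -/
theorem β₁_zero : β₁ 0 = 0 := smoothStep_of_le (by norm_num) le_rfl
/-- At `τ = 0`, `β₂ = 0`. [folklore] -/
theorem β₂_zero : β₂ 0 = 0 := smoothStep_of_le (by norm_num) (by norm_num)
/-- At `τ = 0`, `β₃ = 0`. [folklore] -/
theorem β₃_zero : β₃ 0 = 0 := smoothStep_of_le (by norm_num) (by norm_num)
/-- At `τ = 1` all weights are `1`. [folklore] -/
theorem β₁_one : β₁ 1 = 1 := smoothStep_of_ge (by norm_num) (by norm_num)
/-- At `τ = 1`, `β₂ = 1`. [folklore] -/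
theorem β₂_one : β₂ 1 = 1 := smoothStep_of_ge (by norm_num) (by norm_num)
/-- At `τ = 1`, `β₃ = 1`. [folklore] -/
theorem β₃_one : β₃ 1 = 1 := smoothStep_of_ge (by norm_num) le_rfl

/-- If `β₂ τ ≠ 0` then `β₁ τ = 1` (stage 2 starts after stage 1 is complete). [folklore] -/
theorem β₁_eq_one_of_β₂_ne_zero {τ : ℝ} (h : β₂ τ ≠ 0) : β₁ τ = 1 := by
  by_contra h1
  have hτ : τ < 1 / 3 := lt_of_not_ge fun h' ↦ h1 (smoothStep_of_ge (by norm_num) h')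
  exact h (smoothStep_of_le (by norm_num) hτ.le)

/-- If `β₃ τ ≠ 0` then `β₂ τ = 1`. [folklore] -/
theorem β₂_eq_one_of_β₃_ne_zero {τ : ℝ} (h : β₃ τ ≠ 0) : β₂ τ = 1 := by
  by_contra h1
  have hτ : τ < 2 / 3 := lt_of_not_ge fun h' ↦ h1 (smoothStep_of_ge (by norm_num) h')
  exact h (smoothStep_of_le (by norm_num) hτ.le)

/-- If `β₁ τ = 0` then `β₂ τ = 0`. [folklore] -/
theorem β₂_eq_zero_of_β₁_eq_zero {τ : ℝ} (h : β₁ τ = 0) : β₂ τ = 0 := by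
  by_contra h2; have := β₁_eq_one_of_β₂_ne_zero h2; rw [h] at this; norm_num at this

/-- If `β₃ τ ≠ 0` then `β₁ τ = 1`. [folklore] -/
theorem β₁_eq_one_of_β₃_ne_zero {τ : ℝ} (h : β₃ τ ≠ 0) : β₁ τ = 1 :=
  β₁_eq_one_of_β₂_ne_zero (by rw [β₂_eq_one_of_β₃_ne_zero h]; norm_num)

/-! #### The cut-off `Ω` -/

/-- `Ω ∈ [0, 1]`. [folklore] -/
theorem Ω_mem (L u : ℝ) : Ω L u ∈ Icc (0 : ℝ) 1 := by
  have h1 := smoothStep_mem_Icc (ua L) (ub L) u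
  have h2 := smoothStep_mem_Icc (ua L) (ub L) (-u)
  exact ⟨mul_nonneg h1.1 h2.1, mul_le_one₀ h1.2 h2.1 h2.2⟩

/-- `Ω` is even. [folklore] -/
theorem Ω_neg (L u : ℝ) : Ω L (-u) = Ω L u := by rw [Ω, Ω, neg_neg, mul_comm]

/-- `Ω u = 0` for `u ≤ ua`. [folklore] -/
theorem Ω_of_le_ua (hL : 0 < L) {u : ℝ} (hu : u ≤ ua L) : Ω L u = 0 := by
  rw [Ω, smoothStep_of_le (ua_lt_ub hL) hu, zero_mul]

/-- `Ω u = 0` for `-ua ≤ u`. [folklore] -/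
theorem Ω_of_neg_ua_le (hL : 0 < L) {u : ℝ} (hu : -ua L ≤ u) : Ω L u = 0 := by
  rw [← Ω_neg, Ω_of_le_ua hL (by linarith)]

/-- `Ω u = 1` for `u ∈ [ub, -ub]`. [folklore] -/
theorem Ω_of_mem (hL : 0 < L) {u : ℝ} (hu : u ∈ Icc (ub L) (-ub L)) : Ω L u = 1 := by
  rw [Ω, smoothStep_of_ge (ua_lt_ub hL) hu.1, smoothStep_of_ge (ua_lt_ub hL) (by linarith [hu.2]),
    mul_one]

/-- For `u ≤ 0` the second factor of `Ω` is `1`: `Ω u = smoothStep ua ub u`. [folklore] -/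
theorem Ω_of_nonpos (hL : 0 < L) {u : ℝ} (hu : u ≤ 0) : Ω L u = smoothStep (ua L) (ub L) u := by
  rw [Ω, smoothStep_of_ge (ua_lt_ub hL) (by linarith [ub_neg hL] : ub L ≤ -u), mul_one]

/-- `Ω` is `C^∞`. [folklore] -/
theorem contDiff_Ω (L : ℝ) : ContDiff ℝ ∞ (Ω L) :=
  (contDiff_smoothStep _ _).mul ((contDiff_smoothStep _ _).comp contDiff_neg)

/-- Near a point `u < -ub`, `Ω` agrees with `smoothStep ua ub`. [folklore] -/
theorem Ω_eventuallyEq (hL : 0 < L) {u : ℝ} (hu : u < -ub L) :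
    Ω L =ᶠ[𝓝 u] smoothStep (ua L) (ub L) := by
  filter_upwards [Iio_mem_nhds hu] with v hv
  rw [Ω, smoothStep_of_ge (ua_lt_ub hL) (by linarith [mem_Iio.1 hv] : ub L ≤ -v), mul_one]

/-- `Ω` vanishes identically near any `u < ua`. [folklore] -/
theorem Ω_eventuallyEq_zero (hL : 0 < L) {u : ℝ} (hu : u < ua L) : Ω L =ᶠ[𝓝 u] fun _ ↦ 0 := by
  filter_upwards [Iio_mem_nhds hu] with v hv using Ω_of_le_ua hL hv.le

/-- `Ω` is identically `1` near any `u ∈ (ub, -ub)`. [folklore] -/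
theorem Ω_eventuallyEq_one (hL : 0 < L) {u : ℝ} (hu : u ∈ Ioo (ub L) (-ub L)) :
    Ω L =ᶠ[𝓝 u] fun _ ↦ 1 := by
  filter_upwards [Ioo_mem_nhds hu.1 hu.2] with v hv using Ω_of_mem hL ⟨hv.1.le, hv.2.le⟩

/-! #### The abscissa profile `A` -/

/-- `A` is `C^∞`. [folklore] -/
theorem contDiff_A (L : ℝ) : ContDiff ℝ ∞ (A L) := by
  unfold A
  exact ((contDiff_const.sub (contDiff_Ω L)).mul contDiff_id).add
    ((contDiff_Ω L).mul (contDiff_const.mul (contDiff_cos.comp (contDiff_ang L))))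


/-- `A` is differentiable. [folklore] -/
theorem differentiable_A (L : ℝ) : Differentiable ℝ (A L) := (contDiff_A L).differentiable (by simp)

/-- `A` is odd. [folklore] -/
theorem A_neg (L u : ℝ) : A L (-u) = -A L u := by
  rw [A, A, Ω_neg, cos_ang_neg]; ring

/-- `A 0 = 0`. [folklore] -/
@[simp] theorem A_zero (L : ℝ) : A L 0 = 0 := by
  have h := A_neg L 0; rw [neg_zero] at h; linarith

/-- `A u = u` for `u ≤ ua`. [folklore] -/
theorem A_of_le_ua (hL : 0 < L) {u : ℝ} (hu : u ≤ ua L) : A L u = u := by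
  rw [A, Ω_of_le_ua hL hu]; ring

/-- `A u = u` for `-ua ≤ u`. [folklore] -/
theorem A_of_neg_ua_le (hL : 0 < L) {u : ℝ} (hu : -ua L ≤ u) : A L u = u := by
  rw [A, Ω_of_neg_ua_le hL hu]; ring

/-- `A u = u` for `|u| ≥ 3L/4`, in the form `u ≤ -3L/4`. [folklore] -/
theorem A_of_le (hL : 0 < L) {u : ℝ} (hu : u ≤ -(3 * L / 4)) : A L u = u :=
  A_of_le_ua hL (hu.trans (neg_three_quarters_lt_ua hL).le)

/-- `A u = u` for `3L/4 ≤ u`. [folklore] -/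
theorem A_of_ge (hL : 0 < L) {u : ℝ} (hu : 3 * L / 4 ≤ u) : A L u = u :=
  A_of_neg_ua_le hL (by linarith [neg_three_quarters_lt_ua hL])

/-- `A u = L cos (ang u)` on `[ub, -ub]`. [folklore] -/
theorem A_of_mem (hL : 0 < L) {u : ℝ} (hu : u ∈ Icc (ub L) (-ub L)) : A L u = L * cos (ang L u) := by
  rw [A, Ω_of_mem hL hu]; ring

/-- `A s* = -3L/4` (the corner abscissa). [folklore] -/
theorem A_sStar (hL : 0 < L) : A L (sStar L) = -(3 * L / 4) := by
  rw [A_of_mem hL ⟨((ub_lt_u1 hL).trans (u1_lt_sStar hL)).le, by linarith [sStar_neg hL, ub_neg hL]⟩,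
    ang_sStar hL, cos_phiL]; ring

/-- **`A < 0` on `(-3L/4, 0)`** (indeed on `(-∞, 0)`). [folklore] -/
theorem A_neg_of_neg (hL : 0 < L) {u : ℝ} (hu : u < 0) : A L u < 0 := by
  by_cases h : u ≤ ua L
  · rwa [A_of_le_ua hL h]
  · have hc : L * cos (ang L u) < 0 :=
      mul_neg_of_pos_of_neg hL (cos_ang_neg' hL ⟨lt_of_not_ge h, hu⟩)
    rw [A]
    exact combo_lt_of_lt (Ω_mem L u) hu hc

/-- `0 < A` on `(0, ∞)`. [folklore] -/
theorem A_pos_of_pos (hL : 0 < L) {u : ℝ} (hu : 0 < u) : 0 < A L u := by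
  have := A_neg_of_neg hL (neg_lt_zero.2 hu); rw [A_neg] at this; linarith

/-- `-3L/4 < A u` for `u ∈ (-3L/4, s*)`. [folklore] -/
theorem neg_three_quarters_lt_A (hL : 0 < L) {u : ℝ} (hu : u ∈ Ioo (-(3 * L / 4)) (sStar L)) :
    -(3 * L / 4) < A L u := by
  by_cases h : u ≤ ua L
  · rw [A_of_le_ua hL h]; exact hu.1
  · have hc : -(3 * L / 4) < L * cos (ang L u) := by
      have := neg_three_quarters_lt_cos_ang hL ⟨le_of_not_ge h, hu.2⟩; nlinarith
    rw [A]
    exact lt_combo_of_lt (Ω_mem L u) hu.1 hc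

/-- `|A u| ≤ max |u| L`. [folklore] -/
theorem abs_A_le (L u : ℝ) (hL : 0 ≤ L) : |A L u| ≤ max |u| L := by
  have hΩ := Ω_mem L u
  have hc : |L * cos (ang L u)| ≤ L := by
    rw [abs_mul, abs_of_nonneg hL]; exact mul_le_of_le_one_right hL (abs_cos_le_one _)
  calc |A L u| ≤ |(1 - Ω L u) * u| + |Ω L u * (L * cos (ang L u))| := abs_add_le _ _
    _ = (1 - Ω L u) * |u| + Ω L u * |L * cos (ang L u)| := by
        rw [abs_mul, abs_mul, abs_of_nonneg (by linarith [hΩ.2]), abs_of_nonneg hΩ.1]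
    _ ≤ (1 - Ω L u) * max |u| L + Ω L u * max |u| L := by
        gcongr
        · linarith [hΩ.2]
        · exact le_max_left _ _
        · exact hΩ.1
        · exact hc.trans (le_max_right _ _)
    _ = max |u| L := by ring

/-- Near any `u < ua`, `A` is the identity. [folklore] -/
theorem A_eventuallyEq_id (hL : 0 < L) {u : ℝ} (hu : u < ua L) : A L =ᶠ[𝓝 u] id := by
  filter_upwards [Iio_mem_nhds hu] with v hv using A_of_le_ua hL (le_of_lt hv)

/-- Near any `u > -ua`, `A` is the identity. [folklore] -/
theorem A_eventuallyEq_id' (hL : 0 < L) {u : ℝ} (hu : -ua L < u) : A L =ᶠ[𝓝 u] id := by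
  filter_upwards [Ioi_mem_nhds hu] with v hv using A_of_neg_ua_le hL (le_of_lt hv)

/-- `deriv A = 1` left of `ua`. [folklore] -/
theorem deriv_A_of_lt_ua (hL : 0 < L) {u : ℝ} (hu : u < ua L) : deriv (A L) u = 1 := by
  rw [(A_eventuallyEq_id hL hu).deriv_eq, deriv_id]

/-- `deriv A = 1` right of `-ua`. [folklore] -/
theorem deriv_A_of_neg_ua_lt (hL : 0 < L) {u : ℝ} (hu : -ua L < u) : deriv (A L) u = 1 := by
  rw [(A_eventuallyEq_id' hL hu).deriv_eq, deriv_id]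

/-- Near any `u ∈ (ub, -ub)`, `A = L cos ∘ ang`. [folklore] -/
theorem A_eventuallyEq_cos (hL : 0 < L) {u : ℝ} (hu : u ∈ Ioo (ub L) (-ub L)) :
    A L =ᶠ[𝓝 u] fun v ↦ L * cos (ang L v) := by
  filter_upwards [Ioo_mem_nhds hu.1 hu.2] with v hv using A_of_mem hL ⟨hv.1.le, hv.2.le⟩

/-- The derivative of `A` at `0` is `L k > 0`. [folklore] -/
theorem deriv_A_zero (hL : 0 < L) : deriv (A L) 0 = L * kAng L := by
  rw [(A_eventuallyEq_cos hL ⟨ub_neg hL, by linarith [ub_neg hL]⟩).deriv_eq]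
  have h : HasDerivAt (fun v ↦ L * cos (ang L v)) (L * (-sin (ang L 0) * kAng L)) 0 :=
    ((hasDerivAt_cos _).comp 0 (hasDerivAt_ang L 0)).const_mul L
  rw [h.deriv, ang_zero, show (3 : ℝ) * π / 2 = π / 2 + π by ring, sin_add_pi, sin_pi_div_two]
  ring

/-! #### The auxiliary depth `Ftil` -/

/-- `Ftil` is `C^∞`. [folklore] -/
theorem contDiff_Ftil (L : ℝ) : ContDiff ℝ ∞ (Ftil L) :=
  contDiff_const.mul ((contDiff_smoothStep _ _).mul ((contDiff_smoothStep _ _).comp contDiff_neg))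

/-- `Ftil` is even. [folklore] -/
theorem Ftil_neg (L u : ℝ) : Ftil L (-u) = Ftil L u := by rw [Ftil, Ftil, neg_neg]; ring

/-- For `u ≤ 0`, `Ftil u = L · smoothStep (-3L/4) 0 u`. [folklore] -/
theorem Ftil_of_nonpos (hL : 0 < L) {u : ℝ} (hu : u ≤ 0) :
    Ftil L u = L * smoothStep (-(3 * L / 4)) 0 u := by
  rw [Ftil, smoothStep_of_ge (b := (0:ℝ)) (by linarith) (by linarith : (0:ℝ) ≤ -u), mul_one]

/-- `Ftil u = 0` for `u ≤ -3L/4`. [folklore] -/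
theorem Ftil_of_le (hL : 0 < L) {u : ℝ} (hu : u ≤ -(3 * L / 4)) : Ftil L u = 0 := by
  rw [Ftil_of_nonpos hL (by linarith), smoothStep_of_le (by linarith) hu, mul_zero]

/-- `Ftil u = 0` for `3L/4 ≤ u`. [folklore] -/
theorem Ftil_of_ge (hL : 0 < L) {u : ℝ} (hu : 3 * L / 4 ≤ u) : Ftil L u = 0 := by
  rw [← Ftil_neg, Ftil_of_le hL (by linarith)]

/-- `0 ≤ Ftil ≤ L`. [folklore] -/
theorem Ftil_mem (hL : 0 < L) (u : ℝ) : Ftil L u ∈ Icc 0 L := by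
  have h1 := smoothStep_mem_Icc (-(3 * L / 4)) 0 u
  have h2 := smoothStep_mem_Icc (-(3 * L / 4)) 0 (-u)
  refine ⟨mul_nonneg hL.le (mul_nonneg h1.1 h2.1), ?_⟩
  rw [Ftil]; nlinarith [mul_le_one₀ h1.2 h2.1 h2.2]

/-- `0 < Ftil u` for `|u| < 3L/4`. [folklore] -/
theorem Ftil_pos (hL : 0 < L) {u : ℝ} (hu : u ∈ Ioo (-(3 * L / 4)) (3 * L / 4)) : 0 < Ftil L u := by
  rw [Ftil]
  refine mul_pos hL (mul_pos ?_ ?_)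
  · by_cases h : u < 0
    · exact (smoothStep_mem_Ioo (by linarith) ⟨hu.1, h⟩).1
    · rw [smoothStep_of_ge (by linarith) (le_of_not_gt h)]; exact one_pos
  · by_cases h : -u < 0
    · exact (smoothStep_mem_Ioo (by linarith) ⟨by linarith [hu.2], h⟩).1
    · rw [smoothStep_of_ge (by linarith) (le_of_not_gt h)]; exact one_pos

/-- Near any `u < 0`, `Ftil = L · smoothStep (-3L/4) 0`. [folklore] -/
theorem Ftil_eventuallyEq (hL : 0 < L) {u : ℝ} (hu : u < 0) :
    Ftil L =ᶠ[𝓝 u] fun v ↦ L * smoothStep (-(3 * L / 4)) 0 v := by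
  filter_upwards [Iio_mem_nhds hu] with v hv using Ftil_of_nonpos hL (le_of_lt hv)

/-- `deriv Ftil > 0` on `(-3L/4, 0)`. [folklore] -/
theorem deriv_Ftil_pos (hL : 0 < L) {u : ℝ} (hu : u ∈ Ioo (-(3 * L / 4)) 0) : 0 < deriv (Ftil L) u := by
  rw [(Ftil_eventuallyEq hL hu.2).deriv_eq, deriv_const_mul _ (differentiable_smoothStep _ _ u)]
  exact mul_pos hL (deriv_smoothStep_pos (by linarith) hu)

/-- `Ftil` is strictly increasing on `[-3L/4, 0]`. [folklore] -/
theorem strictMonoOn_Ftil (hL : 0 < L) : StrictMonoOn (Ftil L) (Icc (-(3 * L / 4)) 0) :=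
  strictMonoOn_of_deriv_pos (convex_Icc _ _) (contDiff_Ftil L).continuous.continuousOn
    fun u hu ↦ deriv_Ftil_pos hL (by rwa [interior_Icc] at hu)

/-! #### The base depth `Fbase` -/

/-- `Fbase` is `C^∞`. [folklore] -/
theorem contDiff_Fbase (L : ℝ) : ContDiff ℝ ∞ (Fbase L) :=
  contDiff_const.mul ((contDiff_smoothStep _ _).mul ((contDiff_smoothStep _ _).comp contDiff_neg))

/-- `Fbase` is even. [folklore] -/
theorem Fbase_neg (L u : ℝ) : Fbase L (-u) = Fbase L u := by rw [Fbase, Fbase, neg_neg]; ring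

/-- For `u ≤ 0`, `Fbase u = L · smoothStep (-3L/4) u1 u`. [folklore] -/
theorem Fbase_of_nonpos (hL : 0 < L) {u : ℝ} (hu : u ≤ 0) :
    Fbase L u = L * smoothStep (-(3 * L / 4)) (u1 L) u := by
  have h1 := neg_three_quarters_lt_ua hL; have h2 := ua_lt_ub hL; have h3 := ub_lt_u1 hL
  rw [Fbase, smoothStep_of_ge (b := u1 L) (by linarith) (by linarith [u1_neg hL] : u1 L ≤ -u), mul_one]

/-- Near any `u < 0`, `Fbase = L · smoothStep (-3L/4) u1`. [folklore] -/
theorem Fbase_eventuallyEq (hL : 0 < L) {u : ℝ} (hu : u < 0) :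
    Fbase L =ᶠ[𝓝 u] fun v ↦ L * smoothStep (-(3 * L / 4)) (u1 L) v := by
  filter_upwards [Iio_mem_nhds hu] with v hv using Fbase_of_nonpos hL (le_of_lt hv)

/-- `-3L/4 < u1`. [folklore] -/
theorem neg_three_quarters_lt_u1 (hL : 0 < L) : -(3 * L / 4) < u1 L :=
  (neg_three_quarters_lt_ua hL).trans ((ua_lt_ub hL).trans (ub_lt_u1 hL))

/-- `Fbase u = 0` for `u ≤ -3L/4`. [folklore] -/
theorem Fbase_of_le (hL : 0 < L) {u : ℝ} (hu : u ≤ -(3 * L / 4)) : Fbase L u = 0 := by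
  rw [Fbase_of_nonpos hL (by linarith), smoothStep_of_le (neg_three_quarters_lt_u1 hL) hu, mul_zero]

/-- `Fbase u = L` on `[u1, -u1]`. [folklore] -/
theorem Fbase_of_mem (hL : 0 < L) {u : ℝ} (hu : u ∈ Icc (u1 L) (-u1 L)) : Fbase L u = L := by
  rw [Fbase, smoothStep_of_ge (neg_three_quarters_lt_u1 hL) hu.1,
    smoothStep_of_ge (neg_three_quarters_lt_u1 hL) (by linarith [hu.2] : u1 L ≤ -u)]; ring

/-- `Fbase u < L` for `u < u1`, `u ≤ 0`. [folklore] -/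
theorem Fbase_lt (hL : 0 < L) {u : ℝ} (hu : u < u1 L) : Fbase L u < L := by
  rw [Fbase_of_nonpos hL (hu.le.trans (u1_neg hL).le)]
  have : smoothStep (-(3 * L / 4)) (u1 L) u < 1 := by
    by_cases h : -(3 * L / 4) < u
    · exact (smoothStep_mem_Ioo (neg_three_quarters_lt_u1 hL) ⟨h, hu⟩).2
    · rw [smoothStep_of_le (neg_three_quarters_lt_u1 hL) (le_of_not_gt h)]; exact one_pos
  nlinarith

/-- `0 < Fbase u` for `u ∈ (-3L/4, 0]`. [folklore] -/
theorem Fbase_pos (hL : 0 < L) {u : ℝ} (hu : u ∈ Ioc (-(3 * L / 4)) 0) : 0 < Fbase L u := by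
  rw [Fbase_of_nonpos hL hu.2]
  refine mul_pos hL ?_
  by_cases h : u < u1 L
  · exact (smoothStep_mem_Ioo (neg_three_quarters_lt_u1 hL) ⟨hu.1, h⟩).1
  · rw [smoothStep_of_ge (neg_three_quarters_lt_u1 hL) (le_of_not_gt h)]; exact one_pos

/-- `0 ≤ Fbase`. [folklore] -/
theorem Fbase_nonneg (hL : 0 < L) (u : ℝ) : 0 ≤ Fbase L u :=
  mul_nonneg hL.le (mul_nonneg (smoothStep_mem_Icc _ _ _).1 (smoothStep_mem_Icc _ _ _).1)

/-- `deriv Fbase ≥ 0` at `u < 0`. [folklore] -/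
theorem deriv_Fbase_nonneg (hL : 0 < L) {u : ℝ} (hu : u < 0) : 0 ≤ deriv (Fbase L) u := by
  rw [(Fbase_eventuallyEq hL hu).deriv_eq, deriv_const_mul _ (differentiable_smoothStep _ _ u)]
  exact mul_nonneg hL.le (deriv_smoothStep_nonneg (neg_three_quarters_lt_u1 hL) u)

/-- `deriv Fbase > 0` on `(-3L/4, u1)`. [folklore] -/
theorem deriv_Fbase_pos (hL : 0 < L) {u : ℝ} (hu : u ∈ Ioo (-(3 * L / 4)) (u1 L)) :
    0 < deriv (Fbase L) u := by
  rw [(Fbase_eventuallyEq hL (hu.2.trans (u1_neg hL))).deriv_eq,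
    deriv_const_mul _ (differentiable_smoothStep _ _ u)]
  exact mul_pos hL (deriv_smoothStep_pos (neg_three_quarters_lt_u1 hL) hu)

/-! #### The D-loop correction `spT` -/

/-- `spT` is `C^∞`. [folklore] -/
theorem contDiff_spT (L : ℝ) : ContDiff ℝ ∞ (spT L) :=
  (contDiff_Ω L).mul ((contDiff_sp _).comp
    (contDiff_const.sub (contDiff_const.mul (contDiff_sin.comp (contDiff_ang L)))))

/-- `spT` is even. [folklore] -/
theorem spT_neg (L u : ℝ) : spT L (-u) = spT L u := by rw [spT, spT, Ω_neg, sin_ang_neg]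

/-- `0 ≤ spT`. [folklore] -/
theorem spT_nonneg (hL : 0 < L) (u : ℝ) : 0 ≤ spT L u :=
  mul_nonneg (Ω_mem L u).1 (sp_nonneg (by positivity) _)

/-- `spT u = 0` for `u ≤ s*` (off `(ua, -ua)` the cut-off vanishes, on `[ua, s*]` the angle has
`sin > 1/2`). [folklore] -/
theorem spT_of_le_sStar (hL : 0 < L) {u : ℝ} (hu : u ≤ sStar L) : spT L u = 0 := by
  by_cases h : u ≤ ua L
  · rw [spT, Ω_of_le_ua hL h, zero_mul]
  · rw [spT, sp_of_nonpos (by positivity), mul_zero]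
    have := one_half_lt_sin_ang hL ⟨le_of_not_ge h, hu⟩
    nlinarith

/-- `spT u = 0` for `-s* ≤ u`. [folklore] -/
theorem spT_of_neg_sStar_le (hL : 0 < L) {u : ℝ} (hu : -sStar L ≤ u) : spT L u = 0 := by
  rw [← spT_neg, spT_of_le_sStar hL (by linarith)]

/-- On `[ub, -ub]`, `spT u = sp (L/8) (L/2 - L sin (ang u))`. [folklore] -/
theorem spT_of_mem (hL : 0 < L) {u : ℝ} (hu : u ∈ Icc (ub L) (-ub L)) :
    spT L u = sp (L / 8) (L / 2 - L * sin (ang L u)) := by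
  rw [spT, Ω_of_mem hL hu, one_mul]

/-- Near any `u < s*`, `spT` vanishes identically. [folklore] -/
theorem spT_eventuallyEq_zero (hL : 0 < L) {u : ℝ} (hu : u < sStar L) :
    spT L =ᶠ[𝓝 u] fun _ ↦ 0 := by
  filter_upwards [Iio_mem_nhds hu] with v hv using spT_of_le_sStar hL (le_of_lt hv)

/-- Near any `u ∈ (ub, -ub)`, `spT = sp (L/8) (L/2 - L sin ∘ ang)`. [folklore] -/
theorem spT_eventuallyEq (hL : 0 < L) {u : ℝ} (hu : u ∈ Ioo (ub L) (-ub L)) :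
    spT L =ᶠ[𝓝 u] fun v ↦ sp (L / 8) (L / 2 - L * sin (ang L v)) := by
  filter_upwards [Ioo_mem_nhds hu.1 hu.2] with v hv using spT_of_mem hL ⟨hv.1.le, hv.2.le⟩

/-- `deriv spT ≥ 0` at every `u ≤ 0`. [folklore] -/
theorem deriv_spT_nonneg (hL : 0 < L) {u : ℝ} (hu : u ≤ 0) : 0 ≤ deriv (spT L) u := by
  by_cases h : u < sStar L
  · rw [(spT_eventuallyEq_zero hL h).deriv_eq, deriv_const]
  · have hub : u ∈ Ioo (ub L) (-ub L) :=
      ⟨((ub_lt_u1 hL).trans (u1_lt_sStar hL)).trans_le (le_of_not_gt h), by linarith [ub_neg hL]⟩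
    rw [(spT_eventuallyEq hL hub).deriv_eq]
    have hg : HasDerivAt (fun v ↦ L / 2 - L * sin (ang L v)) (-(L * (cos (ang L u) * kAng L))) u := by
      simpa using (((hasDerivAt_sin _).comp u (hasDerivAt_ang L u)).const_mul L).const_sub (L / 2)
    have hd : HasDerivAt (fun v ↦ sp (L / 8) (L / 2 - L * sin (ang L v)))
        (deriv (sp (L / 8)) (L / 2 - L * sin (ang L u)) * -(L * (cos (ang L u) * kAng L))) u :=
      ((differentiable_sp (L / 8)) _).hasDerivAt.comp u hg
    rw [hd.deriv]
    have h1 := deriv_sp_nonneg (by positivity : 0 < L / 8) (L / 2 - L * sin (ang L u))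
    have h2 : cos (ang L u) ≤ 0 :=
      cos_ang_nonpos hL ⟨(ua_lt_ub hL).le.trans hub.1.le, hu⟩
    have h3 := kAng_pos hL
    have h4 : cos (ang L u) * kAng L ≤ 0 := mul_nonpos_of_nonpos_of_nonneg h2 h3.le
    have : 0 ≤ -(L * (cos (ang L u) * kAng L)) := by nlinarith
    exact mul_nonneg h1 this

/-! #### The final depth `Fst` -/

/-- `Fst` is `C^∞`. [folklore] -/
theorem contDiff_Fst (L : ℝ) : ContDiff ℝ ∞ (Fst L) := (contDiff_Fbase L).add (contDiff_spT L)

/-- `Fst` is differentiable. [folklore] -/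
theorem differentiable_Fst (L : ℝ) : Differentiable ℝ (Fst L) := (contDiff_Fst L).differentiable (by simp)

/-- `Fst` is even. [folklore] -/
theorem Fst_neg (L u : ℝ) : Fst L (-u) = Fst L u := by rw [Fst, Fst, Fbase_neg, spT_neg]

/-- `Fst = Fbase` on `(-∞, s*]`. [folklore] -/
theorem Fst_of_le_sStar (hL : 0 < L) {u : ℝ} (hu : u ≤ sStar L) : Fst L u = Fbase L u := by
  rw [Fst, spT_of_le_sStar hL hu, add_zero]

/-- `Fst u = 0` for `u ≤ -3L/4`. [folklore] -/
theorem Fst_of_le (hL : 0 < L) {u : ℝ} (hu : u ≤ -(3 * L / 4)) : Fst L u = 0 := by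
  rw [Fst_of_le_sStar hL (hu.trans (neg_three_quarters_lt_sStar hL).le), Fbase_of_le hL hu]

/-- `Fst u = 0` for `3L/4 ≤ u`. [folklore] -/
theorem Fst_of_ge (hL : 0 < L) {u : ℝ} (hu : 3 * L / 4 ≤ u) : Fst L u = 0 := by
  rw [← Fst_neg, Fst_of_le hL (by linarith)]

/-- `0 ≤ Fst`. [folklore] -/
theorem Fst_nonneg (hL : 0 < L) (u : ℝ) : 0 ≤ Fst L u :=
  add_nonneg (Fbase_nonneg hL u) (spT_nonneg hL u)

/-- `Fst s* = L` (the corner depth). [folklore] -/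
theorem Fst_sStar (hL : 0 < L) : Fst L (sStar L) = L := by
  rw [Fst_of_le_sStar hL le_rfl, Fbase_of_mem hL ⟨(u1_lt_sStar hL).le, by linarith [sStar_neg hL, u1_neg hL]⟩]

/-- On `[u1, -u1]`, `Fst` is the depth of the D-loop: `Fst u = L + sp (L/8) (L/2 - L sin (ang u))`.
[folklore] -/
theorem Fst_of_mem (hL : 0 < L) {u : ℝ} (hu : u ∈ Icc (u1 L) (-u1 L)) :
    Fst L u = L + sp (L / 8) (L / 2 - L * sin (ang L u)) := by
  rw [Fst, Fbase_of_mem hL hu, spT_of_mem hL ⟨(ub_lt_u1 hL).le.trans hu.1, by linarith [hu.2, ub_lt_u1 hL]⟩]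

/-- `L ≤ Fst u` on `[u1, -u1]`. [folklore] -/
theorem le_Fst_of_mem (hL : 0 < L) {u : ℝ} (hu : u ∈ Icc (u1 L) (-u1 L)) : L ≤ Fst L u := by
  rw [Fst_of_mem hL hu]; linarith [sp_nonneg (by positivity : 0 < L / 8) (L / 2 - L * sin (ang L u))]

/-- `Fst u < L` for `u < u1`. [folklore] -/
theorem Fst_lt (hL : 0 < L) {u : ℝ} (hu : u < u1 L) : Fst L u < L := by
  rw [Fst_of_le_sStar hL (hu.le.trans (u1_lt_sStar hL).le)]; exact Fbase_lt hL hu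

/-- `0 < Fst u` for `u ∈ (-3L/4, 0]`. [folklore] -/
theorem Fst_pos (hL : 0 < L) {u : ℝ} (hu : u ∈ Ioc (-(3 * L / 4)) 0) : 0 < Fst L u :=
  add_pos_of_pos_of_nonneg (Fbase_pos hL hu) (spT_nonneg hL u)

/-- `0 < Fst u` for `|u| < 3L/4`. [folklore] -/
theorem Fst_pos' (hL : 0 < L) {u : ℝ} (hu : u ∈ Ioo (-(3 * L / 4)) (3 * L / 4)) : 0 < Fst L u := by
  rcases le_or_gt u 0 with h | h
  · exact Fst_pos hL ⟨hu.1, h⟩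
  · rw [← Fst_neg]; exact Fst_pos hL ⟨by linarith [hu.2], by linarith⟩

/-- `Fst ≤ L` on `(-∞, s*]`... more precisely `Fst u ≤ L` for `u ≤ s*`. [folklore] -/
theorem Fst_le_of_le_sStar (hL : 0 < L) {u : ℝ} (hu : u ≤ sStar L) : Fst L u ≤ L := by
  rw [Fst_of_le_sStar hL hu, Fbase_of_nonpos hL (hu.trans (sStar_neg hL).le)]
  exact mul_le_of_le_one_right hL.le (smoothStep_mem_Icc _ _ _).2

/-- `deriv Fst ≥ 0` at every `u < 0`. [folklore] -/
theorem deriv_Fst_nonneg (hL : 0 < L) {u : ℝ} (hu : u < 0) : 0 ≤ deriv (Fst L) u := by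
  have h : deriv (Fst L) u = deriv (Fbase L) u + deriv (spT L) u :=
    deriv_add ((contDiff_Fbase L).differentiable (by simp) u) ((contDiff_spT L).differentiable (by simp) u)
  rw [h]; exact add_nonneg (deriv_Fbase_nonneg hL hu) (deriv_spT_nonneg hL hu.le)

/-- `deriv Fst > 0` on `(-3L/4, u1)`. [folklore] -/
theorem deriv_Fst_pos (hL : 0 < L) {u : ℝ} (hu : u ∈ Ioo (-(3 * L / 4)) (u1 L)) : 0 < deriv (Fst L) u := by
  have h : deriv (Fst L) u = deriv (Fbase L) u + deriv (spT L) u :=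
    deriv_add ((contDiff_Fbase L).differentiable (by simp) u) ((contDiff_spT L).differentiable (by simp) u)
  rw [h]
  exact add_pos_of_pos_of_nonneg (deriv_Fbase_pos hL hu) (deriv_spT_nonneg hL (hu.2.trans (u1_neg hL)).le)

/-- `Fst` is monotone on `[-3L/4, 0]`. [folklore] -/
theorem monotoneOn_Fst (hL : 0 < L) : MonotoneOn (Fst L) (Icc (-(3 * L / 4)) 0) :=
  monotoneOn_of_deriv_nonneg (convex_Icc _ _) (contDiff_Fst L).continuous.continuousOn
    (fun u _ ↦ ((differentiable_Fst L) u).differentiableWithinAt)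
    fun u hu ↦ deriv_Fst_nonneg hL (by rw [interior_Icc] at hu; exact hu.2)

/-- `Fst` is strictly increasing on `[-3L/4, u1]`. [folklore] -/
theorem strictMonoOn_Fst (hL : 0 < L) : StrictMonoOn (Fst L) (Icc (-(3 * L / 4)) (u1 L)) :=
  strictMonoOn_of_deriv_pos (convex_Icc _ _) (contDiff_Fst L).continuous.continuousOn
    fun u hu ↦ deriv_Fst_pos hL (by rwa [interior_Icc] at hu)

/-! #### The mushroom family: algebra -/

/-- `mush` is jointly `C^∞`. [folklore] -/
theorem contDiff_mush (L : ℝ) : ContDiff ℝ ∞ fun p : ℝ × ℝ ↦ mush L p.1 p.2 := by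
  unfold mush absc dep
  have hb1 : ContDiff ℝ ∞ fun p : ℝ × ℝ ↦ β₁ p.1 := (contDiff_smoothStep _ _).comp contDiff_fst
  have hb2 : ContDiff ℝ ∞ fun p : ℝ × ℝ ↦ β₂ p.1 := (contDiff_smoothStep _ _).comp contDiff_fst
  have hb3 : ContDiff ℝ ∞ fun p : ℝ × ℝ ↦ β₃ p.1 := (contDiff_smoothStep _ _).comp contDiff_fst
  have hA : ContDiff ℝ ∞ fun p : ℝ × ℝ ↦ A L p.2 := (contDiff_A L).comp contDiff_snd
  have hF : ContDiff ℝ ∞ fun p : ℝ × ℝ ↦ Fst L p.2 := (contDiff_Fst L).comp contDiff_snd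
  have hFt : ContDiff ℝ ∞ fun p : ℝ × ℝ ↦ Ftil L p.2 := (contDiff_Ftil L).comp contDiff_snd
  exact contDiff_pt2 (((contDiff_const.sub hb2).mul contDiff_snd).add (hb2.mul hA))
    (hb1.mul (((contDiff_const.sub hb3).mul hFt).add (hb3.mul hF)))

/-- Each stage of `mush` is `C^∞`. [folklore] -/
theorem contDiff_mush_stage (L τ : ℝ) : ContDiff ℝ ∞ (mush L τ) := by
  have : mush L τ = (fun p : ℝ × ℝ ↦ mush L p.1 p.2) ∘ fun u ↦ (τ, u) := rfl
  rw [this]; exact (contDiff_mush L).comp (contDiff_const.prodMk contDiff_id)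

/-- `absc` is `C^∞` in `u`. [folklore] -/
theorem contDiff_absc (L τ : ℝ) : ContDiff ℝ ∞ (absc L τ) := by
  unfold absc; exact (contDiff_const.mul contDiff_id).add (contDiff_const.mul (contDiff_A L))

/-- `dep` is `C^∞` in `u`. [folklore] -/
theorem contDiff_dep (L τ : ℝ) : ContDiff ℝ ∞ (dep L τ) := by
  unfold dep
  exact contDiff_const.mul ((contDiff_const.mul (contDiff_Ftil L)).add (contDiff_const.mul (contDiff_Fst L)))

/-- `absc` is odd in `u`. [folklore] -/
theorem absc_neg (L τ u : ℝ) : absc L τ (-u) = -absc L τ u := by rw [absc, absc, A_neg]; ring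

/-- `dep` is even in `u`. [folklore] -/
theorem dep_neg (L τ u : ℝ) : dep L τ (-u) = dep L τ u := by rw [dep, dep, Ftil_neg, Fst_neg]

/-- Coordinates of `mush`. [folklore] -/
@[simp] theorem mush_apply_zero (L τ u : ℝ) : mush L τ u 0 = absc L τ u := rfl

/-- Coordinates of `mush`. [folklore] -/
@[simp] theorem mush_apply_one (L τ u : ℝ) : mush L τ u 1 = dep L τ u := rfl

/-- **Mirror symmetry**: `mush L τ (-u)` is the reflection of `mush L τ u` in the depth axis.
[folklore] -/
theorem mush_neg (L τ u : ℝ) : mush L τ (-u) = pt2 (-absc L τ u) (dep L τ u) := by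
  rw [mush, absc_neg, dep_neg]

/-- **Stage `0` is the straight arc**: `mush L 0 u = (u, 0)`. [folklore] -/
theorem mush_zero (L u : ℝ) : mush L 0 u = pt2 u 0 := by
  rw [mush, absc, dep, β₁_zero, β₂_zero]; simp

/-- `absc τ u = u` for `u ≤ -3L/4`. [folklore] -/
theorem absc_of_le (hL : 0 < L) (τ : ℝ) {u : ℝ} (hu : u ≤ -(3 * L / 4)) : absc L τ u = u := by
  rw [absc, A_of_le hL hu]; ring

/-- `absc τ u = u` for `3L/4 ≤ u`. [folklore] -/
theorem absc_of_ge (hL : 0 < L) (τ : ℝ) {u : ℝ} (hu : 3 * L / 4 ≤ u) : absc L τ u = u := by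
  rw [absc, A_of_ge hL hu]; ring

/-- `dep τ u = 0` for `u ≤ -3L/4`. [folklore] -/
theorem dep_of_le (hL : 0 < L) (τ : ℝ) {u : ℝ} (hu : u ≤ -(3 * L / 4)) : dep L τ u = 0 := by
  rw [dep, Ftil_of_le hL hu, Fst_of_le hL hu]; ring

/-- `dep τ u = 0` for `3L/4 ≤ u`. [folklore] -/
theorem dep_of_ge (hL : 0 < L) (τ : ℝ) {u : ℝ} (hu : 3 * L / 4 ≤ u) : dep L τ u = 0 := by
  rw [dep, Ftil_of_ge hL hu, Fst_of_ge hL hu]; ring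

/-- **The family fixes the arc outside `(-3L/4, 3L/4)`**: `mush L τ u = (u, 0)` for `u ≤ -3L/4`.
[folklore] -/
theorem mush_of_le (hL : 0 < L) (τ : ℝ) {u : ℝ} (hu : u ≤ -(3 * L / 4)) : mush L τ u = pt2 u 0 := by
  rw [mush, absc_of_le hL τ hu, dep_of_le hL τ hu]

/-- `mush L τ u = (u, 0)` for `3L/4 ≤ u`. [folklore] -/
theorem mush_of_ge (hL : 0 < L) (τ : ℝ) {u : ℝ} (hu : 3 * L / 4 ≤ u) : mush L τ u = pt2 u 0 := by
  rw [mush, absc_of_ge hL τ hu, dep_of_ge hL τ hu]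

/-- `mush L τ u = (u, 0)` for `|u| ≥ 3L/4`. [folklore] -/
theorem mush_of_le_abs (hL : 0 < L) (τ : ℝ) {u : ℝ} (hu : 3 * L / 4 ≤ |u|) : mush L τ u = pt2 u 0 := by
  rcases le_abs'.1 hu with h | h
  · exact mush_of_le hL τ h
  · exact mush_of_ge hL τ h

/-- **The abscissa has the sign of the parameter**: `absc τ u < 0` for `u < 0`. [folklore] -/
theorem absc_neg_of_neg (hL : 0 < L) (τ : ℝ) {u : ℝ} (hu : u < 0) : absc L τ u < 0 := by
  rw [absc]; exact combo_lt_of_lt (β₂_mem τ) hu (A_neg_of_neg hL hu)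

/-- `0 < absc τ u` for `0 < u`. [folklore] -/
theorem absc_pos_of_pos (hL : 0 < L) (τ : ℝ) {u : ℝ} (hu : 0 < u) : 0 < absc L τ u := by
  have := absc_neg_of_neg hL τ (neg_lt_zero.2 hu); rw [absc_neg] at this; linarith

/-- `absc τ 0 = 0`. [folklore] -/
@[simp] theorem absc_zero (L τ : ℝ) : absc L τ 0 = 0 := by simp [absc]

/-- `|absc τ u| ≤ max |u| L`. [folklore] -/
theorem abs_absc_le (hL : 0 < L) (τ u : ℝ) : |absc L τ u| ≤ max |u| L := by
  have hb := β₂_mem τ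
  calc |absc L τ u| ≤ |(1 - β₂ τ) * u| + |β₂ τ * A L u| := abs_add_le _ _
    _ = (1 - β₂ τ) * |u| + β₂ τ * |A L u| := by
        rw [abs_mul, abs_mul, abs_of_nonneg (by linarith [hb.2]), abs_of_nonneg hb.1]
    _ ≤ (1 - β₂ τ) * max |u| L + β₂ τ * max |u| L := by
        gcongr
        · linarith [hb.2]
        · exact le_max_left _ _
        · exact hb.1
        · exact abs_A_le L u hL.le
    _ = max |u| L := by ring

/-- `0 ≤ dep`. [folklore] -/
theorem dep_nonneg (hL : 0 < L) (τ u : ℝ) : 0 ≤ dep L τ u := by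
  have h1 := β₁_mem τ; have h3 := β₃_mem τ
  have := (Ftil_mem hL u).1; have := Fst_nonneg hL u
  rw [dep]; exact mul_nonneg h1.1 (by nlinarith [h3.1, h3.2])

/-- `0 < dep τ u` for `|u| < 3L/4` once `β₁ τ ≠ 0`. [folklore] -/
theorem dep_pos (hL : 0 < L) {τ u : ℝ} (hτ : β₁ τ ≠ 0) (hu : u ∈ Ioo (-(3 * L / 4)) (3 * L / 4)) :
    0 < dep L τ u := by
  have h1 := β₁_mem τ
  rw [dep]
  exact mul_pos (lt_of_le_of_ne h1.1 (Ne.symm hτ))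
    (lt_combo_of_lt (β₃_mem τ) (Ftil_pos hL hu) (Fst_pos' hL hu))

/-- **The final curve beyond the plateau start is the D-loop**: `mush L 1 u = dloop L 1 (ang u)` for
`u ∈ [u1, -u1]`. [folklore] -/
theorem mush_one_eq_dloop (hL : 0 < L) {u : ℝ} (hu : u ∈ Icc (u1 L) (-u1 L)) :
    mush L 1 u = dloop L 1 (ang L u) := by
  have hub : u ∈ Icc (ub L) (-ub L) := ⟨(ub_lt_u1 hL).le.trans hu.1, by linarith [hu.2, ub_lt_u1 hL]⟩
  rw [mush, absc, dep, β₁_one, β₂_one, β₃_one, A_of_mem hL hub, Fst_of_mem hL hu, dloop, spFam_one]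
  congr 1 <;> ring

/-- Near any `u ∈ (u1, -u1)` the final curve is `dloop L 1 ∘ ang`. [folklore] -/
theorem mush_one_eventuallyEq (hL : 0 < L) {u : ℝ} (hu : u ∈ Ioo (u1 L) (-u1 L)) :
    mush L 1 =ᶠ[𝓝 u] fun v ↦ dloop L 1 (ang L v) := by
  filter_upwards [Ioo_mem_nhds hu.1 hu.2] with v hv using mush_one_eq_dloop hL ⟨hv.1.le, hv.2.le⟩

/-- **The final curve at the corner parameter**: `mush L 1 s* = (-3L/4, L)`. [folklore] -/
theorem mush_one_sStar (hL : 0 < L) : mush L 1 (sStar L) = pt2 (-(3 * L / 4)) L := by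
  rw [mush, absc, dep, β₁_one, β₂_one, β₃_one, A_sStar hL, Fst_sStar hL]; congr 1 <;> ring

/-- `mush L 1 (-s*) = (3L/4, L)`. [folklore] -/
theorem mush_one_neg_sStar (hL : 0 < L) : mush L 1 (-sStar L) = pt2 (3 * L / 4) L := by
  rw [mush_neg, show absc L 1 (sStar L) = -(3 * L / 4) by simpa using congrArg (· 0) (mush_one_sStar hL),
    show dep L 1 (sStar L) = L by simpa using congrArg (· 1) (mush_one_sStar hL), neg_neg]

/-- The final curve at `τ = 1`: `mush L 1 u = (A u, Fst u)`. [folklore] -/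
theorem mush_one (L u : ℝ) : mush L 1 u = pt2 (A L u) (Fst L u) := by
  rw [mush, absc, dep, β₁_one, β₂_one, β₃_one]; congr 1 <;> ring


/-- When `β₃ τ = 1` the stage is the final one: `mush L τ = mush L 1`. [folklore] -/
theorem mush_of_β₃_eq_one {τ : ℝ} (h : β₃ τ = 1) (L : ℝ) : mush L τ = mush L 1 := by
  have h2 : β₂ τ = 1 := β₂_eq_one_of_β₃_ne_zero (by rw [h]; norm_num)
  have h1 : β₁ τ = 1 := β₁_eq_one_of_β₃_ne_zero (by rw [h]; norm_num)
  funext u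
  rw [mush, mush, absc, absc, dep, dep, h, h1, h2, β₁_one, β₂_one, β₃_one]

/-- When `β₁ τ = 0` the stage is the straight arc: `mush L τ u = (u, 0)`. [folklore] -/
theorem mush_of_β₁_eq_zero {τ : ℝ} (h : β₁ τ = 0) (L u : ℝ) : mush L τ u = pt2 u 0 := by
  rw [mush, absc, dep, h, β₂_eq_zero_of_β₁_eq_zero h]; simp

/-! #### Injectivity of the stages -/

/-- `dep` is strictly increasing on `[-3L/4, 0]` during stages 1–3 (`β₁ τ ≠ 0`, `β₃ τ < 1`).
[folklore] -/
theorem strictMonoOn_dep (hL : 0 < L) {τ : ℝ} (h1 : β₁ τ ≠ 0) (h3 : β₃ τ < 1) :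
    StrictMonoOn (dep L τ) (Icc (-(3 * L / 4)) 0) := by
  intro a ha b hb hab
  have hFt := strictMonoOn_Ftil hL ha hb hab
  have hF := monotoneOn_Fst hL ha hb hab.le
  have hb1 := β₁_mem τ; have hb3 := β₃_mem τ
  have hβ₁ : 0 < β₁ τ := lt_of_le_of_ne hb1.1 (Ne.symm h1)
  rw [dep, dep]
  refine mul_lt_mul_of_pos_left ?_ hβ₁
  nlinarith [mul_le_mul_of_nonneg_left hF hb3.1]

/-- For `u, v ∈ [u1, 0]`... more generally in `[u1, -u1]`, equal angles modulo `2π` are equal.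
[folklore] -/
theorem ang_eq_of_exists (hL : 0 < L) {u v : ℝ} (hu : u ∈ Icc (u1 L) (-u1 L)) (hv : v ∈ Icc (u1 L) (-u1 L))
    {m : ℤ} (h : ang L u = ang L v + m * (2 * π)) : u = v := by
  have hr : ang L (-u1 L) - ang L (u1 L) < 2 * π := by
    have e1 : ang L (-u1 L) = 3 * π / 2 + (3 * π / 2 - ang L (u1 L)) := by unfold ang; ring
    rw [e1, ang_u1 hL]; linarith [delta_pos]
  have hu' := (ang_le_ang hL).2 hu.1; have hu'' := (ang_le_ang hL).2 hu.2
  have hv' := (ang_le_ang hL).2 hv.1; have hv'' := (ang_le_ang hL).2 hv.2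
  have hm : (m : ℝ) = 0 := by
    have h1 : (m : ℝ) * (2 * π) < 2 * π := by linarith
    have h2 : -(2 * π) < (m : ℝ) * (2 * π) := by linarith
    have hm1 : (m : ℝ) < 1 := by nlinarith [pi_pos]
    have hm2 : (-1 : ℝ) < m := by nlinarith [pi_pos]
    have : m = 0 := by
      have a : m < 1 := by exact_mod_cast hm1
      have b : -1 < m := by exact_mod_cast hm2
      omega
    simp [this]
  rw [hm, zero_mul, add_zero] at h
  exact le_antisymm ((ang_le_ang hL).1 h.le) ((ang_le_ang hL).1 h.ge)

/-- The left-branch case of injectivity: two parameters `u < v < 0`... `u < v ≤ 0`... give different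
points. [folklore] -/
theorem mush_ne_of_lt_of_nonpos (hL : 0 < L) (τ : ℝ) {u v : ℝ} (huv : u < v) (hv : v ≤ 0) :
    mush L τ u ≠ mush L τ v := by
  intro h
  rw [mush, mush, pt2_eq_pt2_iff] at h
  obtain ⟨ha, hd⟩ := h
  have hq : -(3 * L / 4) < v → v ∈ Ioo (-(3 * L / 4)) (3 * L / 4) := fun h ↦ ⟨h, by linarith⟩
  by_cases h1 : β₁ τ = 0
  · rw [absc, absc, β₂_eq_zero_of_β₁_eq_zero h1] at ha; simp at ha; linarith
  by_cases hv3 : v ≤ -(3 * L / 4)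
  · rw [absc_of_le hL τ (huv.le.trans hv3), absc_of_le hL τ hv3] at ha; linarith
  push Not at hv3
  by_cases hu3 : u ≤ -(3 * L / 4)
  · rw [dep_of_le hL τ hu3] at hd
    exact (dep_pos hL h1 (hq hv3)).ne' hd.symm
  push Not at hu3
  by_cases h3 : β₃ τ < 1
  · have := strictMonoOn_dep hL h1 h3 ⟨hu3.le, huv.le.trans hv⟩ ⟨hv3.le, hv⟩ huv
    linarith
  · have h3' : β₃ τ = 1 := le_antisymm (β₃_mem τ).2 (le_of_not_gt h3)
    have hm : mush L τ = mush L 1 := mush_of_β₃_eq_one h3' L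
    have ha1 : A L u = A L v := by
      have eu := congrArg (fun g ↦ g u 0) hm; have ev := congrArg (fun g ↦ g v 0) hm
      simp only [mush_apply_zero] at eu ev
      have e : absc L 1 u = absc L 1 v := by rw [← eu, ← ev]; exact ha
      rw [absc, absc, β₂_one] at e; simpa using e
    have hd1 : Fst L u = Fst L v := by
      have e : dep L 1 u = dep L 1 v := by
        have h1u := congrArg (fun g ↦ g u 1) hm; have h1v := congrArg (fun g ↦ g v 1) hm
        simp only [mush_apply_one] at h1u h1v
        rw [← h1u, ← h1v]; exact hd
      rw [dep, dep, β₁_one, β₃_one] at e; simpa using e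
    by_cases hvu1 : v < u1 L
    · have := strictMonoOn_Fst hL ⟨hu3.le, (huv.trans hvu1).le⟩ ⟨hv3.le, hvu1.le⟩ huv
      linarith
    push Not at hvu1
    have hvm : v ∈ Icc (u1 L) (-u1 L) := ⟨hvu1, by linarith [u1_neg hL]⟩
    by_cases huu1 : u < u1 L
    · have := Fst_lt hL huu1; have := le_Fst_of_mem hL hvm; linarith
    push Not at huu1
    have hum : u ∈ Icc (u1 L) (-u1 L) := ⟨huu1, by linarith [u1_neg hL]⟩
    have e : dloop L 1 (ang L u) = dloop L 1 (ang L v) := by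
      rw [← mush_one_eq_dloop hL hum, ← mush_one_eq_dloop hL hvm, mush_one, mush_one, ha1, hd1]
    obtain ⟨m, hm'⟩ := dloop_eq_dloop_imp hL ⟨zero_le_one, le_rfl⟩ e
    have := ang_eq_of_exists hL hum hvm hm'
    linarith

/-- **Each stage of the mushroom family is injective.** [folklore] -/
theorem mush_injective (hL : 0 < L) (τ : ℝ) : Injective (mush L τ) := by
  suffices key : ∀ u v, u < v → mush L τ u ≠ mush L τ v by
    intro u v h
    by_contra hne
    rcases lt_or_gt_of_ne hne with hlt | hlt
    · exact key _ _ hlt h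
    · exact key _ _ hlt h.symm
  intro u v huv h
  rcases le_or_gt v 0 with hv | hv
  · exact mush_ne_of_lt_of_nonpos hL τ huv hv h
  · -- `v > 0`: the abscissa of `v` is positive, hence so is that of `u`, hence `u > 0`; mirror.
    have ha : absc L τ u = absc L τ v := by simpa using congrArg (· 0) h
    have hu : 0 < u := by
      by_contra hle; push Not at hle
      have h1 := absc_pos_of_pos hL τ hv
      rcases lt_or_eq_of_le hle with hlt | heq
      · have := absc_neg_of_neg hL τ hlt; linarith
      · rw [heq, absc_zero] at ha; linarith
    have h' : mush L τ (-v) = mush L τ (-u) := by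
      rw [mush_neg, mush_neg, show absc L τ v = absc L τ u from ha.symm,
        show dep L τ v = dep L τ u by simpa using (congrArg (· 1) h).symm]
    exact mush_ne_of_lt_of_nonpos hL τ (by linarith) (by linarith) h'

/-! #### Regularity of the stages -/

/-- Derivative of an odd function at `-x`. [folklore] -/
theorem deriv_neg_of_odd {f : ℝ → ℝ} (h : ∀ x, f (-x) = -f x) (x : ℝ) : deriv f (-x) = deriv f x := by
  have h1 : deriv (fun y ↦ f (-y)) x = -deriv f (-x) := deriv_comp_neg f x
  have h2 : (fun y ↦ f (-y)) = fun y ↦ -f y := funext h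
  have h3 : deriv (fun y ↦ -f y) x = -deriv f x := deriv.fun_neg
  rw [h2, h3] at h1
  linarith

/-- Derivative of an even function at `-x`. [folklore] -/
theorem deriv_neg_of_even {f : ℝ → ℝ} (h : ∀ x, f (-x) = f x) (x : ℝ) : deriv f (-x) = -deriv f x := by
  have h1 : deriv (fun y ↦ f (-y)) x = -deriv f (-x) := deriv_comp_neg f x
  have h2 : (fun y ↦ f (-y)) = f := funext h
  rw [h2] at h1
  linarith

/-- `absc` is differentiable. [folklore] -/
theorem differentiable_absc (L τ : ℝ) : Differentiable ℝ (absc L τ) :=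
  (contDiff_absc L τ).differentiable (by simp)

/-- `dep` is differentiable. [folklore] -/
theorem differentiable_dep (L τ : ℝ) : Differentiable ℝ (dep L τ) :=
  (contDiff_dep L τ).differentiable (by simp)

/-- The derivative of `absc`. [folklore] -/
theorem deriv_absc (L τ u : ℝ) : deriv (absc L τ) u = (1 - β₂ τ) + β₂ τ * deriv (A L) u := by
  show deriv (fun u ↦ (1 - β₂ τ) * u + β₂ τ * A L u) u = _
  have h : HasDerivAt (fun u ↦ (1 - β₂ τ) * u + β₂ τ * A L u)
      ((1 - β₂ τ) * 1 + β₂ τ * deriv (A L) u) u :=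
    ((hasDerivAt_id' u).const_mul _).fun_add (((differentiable_A L) u).hasDerivAt.const_mul _)
  rw [h.deriv, mul_one]

/-- The derivative of `dep`. [folklore] -/
theorem deriv_dep (L τ u : ℝ) : deriv (dep L τ) u =
    β₁ τ * ((1 - β₃ τ) * deriv (Ftil L) u + β₃ τ * deriv (Fst L) u) := by
  show deriv (fun u ↦ β₁ τ * ((1 - β₃ τ) * Ftil L u + β₃ τ * Fst L u)) u = _
  have h : HasDerivAt (fun u ↦ β₁ τ * ((1 - β₃ τ) * Ftil L u + β₃ τ * Fst L u))
      (β₁ τ * ((1 - β₃ τ) * deriv (Ftil L) u + β₃ τ * deriv (Fst L) u)) u :=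
    ((((contDiff_Ftil L).differentiable (by simp) u).hasDerivAt.const_mul _).fun_add
      (((differentiable_Fst L) u).hasDerivAt.const_mul _)).const_mul _
  rw [h.deriv]

/-- The derivative of a stage of `mush`. [folklore] -/
theorem hasDerivAt_mush (L τ u : ℝ) :
    HasDerivAt (mush L τ) (pt2 (deriv (absc L τ) u) (deriv (dep L τ) u)) u :=
  hasDerivAt_pt2 ((differentiable_absc L τ) u).hasDerivAt ((differentiable_dep L τ) u).hasDerivAt

/-- `deriv (mush L τ) u = (deriv absc, deriv dep)`. [folklore] -/
theorem deriv_mush (L τ u : ℝ) : deriv (mush L τ) u = pt2 (deriv (absc L τ) u) (deriv (dep L τ) u) :=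
  (hasDerivAt_mush L τ u).deriv

/-- `deriv absc` is even in `u`. [folklore] -/
theorem deriv_absc_neg (L τ u : ℝ) : deriv (absc L τ) (-u) = deriv (absc L τ) u :=
  deriv_neg_of_odd (absc_neg L τ) u

/-- `deriv dep` is odd in `u`. [folklore] -/
theorem deriv_dep_neg (L τ u : ℝ) : deriv (dep L τ) (-u) = -deriv (dep L τ) u :=
  deriv_neg_of_even (dep_neg L τ) u

/-- `deriv absc = 1` left of `ua`. [folklore] -/
theorem deriv_absc_of_lt_ua (hL : 0 < L) (τ : ℝ) {u : ℝ} (hu : u < ua L) : deriv (absc L τ) u = 1 := by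
  rw [deriv_absc, deriv_A_of_lt_ua hL hu]; ring

/-- `deriv absc 0 > 0`. [folklore] -/
theorem deriv_absc_zero_pos (hL : 0 < L) (τ : ℝ) : 0 < deriv (absc L τ) 0 := by
  rw [deriv_absc, deriv_A_zero hL]
  have := lt_combo_of_lt (β₂_mem τ) one_pos (mul_pos hL (kAng_pos hL))
  simpa using this

/-- `deriv dep > 0` on `(-3L/4, 0)` during stages 1–3 (`β₁ ≠ 0`, `β₃ < 1`). [folklore] -/
theorem deriv_dep_pos (hL : 0 < L) {τ u : ℝ} (h1 : β₁ τ ≠ 0) (h3 : β₃ τ < 1)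
    (hu : u ∈ Ioo (-(3 * L / 4)) 0) : 0 < deriv (dep L τ) u := by
  rw [deriv_dep]
  have hb1 := β₁_mem τ; have hb3 := β₃_mem τ
  refine mul_pos (lt_of_le_of_ne hb1.1 (Ne.symm h1)) ?_
  have hFt := deriv_Ftil_pos hL hu
  have hF := deriv_Fst_nonneg hL hu.2
  nlinarith [mul_nonneg hb3.1 hF]

/-- The velocity of the final curve beyond `u1`: `k • (dloop L 1)' (ang u)`. [folklore] -/
theorem deriv_mush_one_of_mem (hL : 0 < L) {u : ℝ} (hu : u ∈ Ioo (u1 L) (-u1 L)) :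
    deriv (mush L 1) u = kAng L • deriv (dloop L 1) (ang L u) := by
  rw [(mush_one_eventuallyEq hL hu).deriv_eq]
  have h := (((contDiff_dloop_stage L 1).differentiable (by simp)) (ang L u)).hasDerivAt.scomp u
    (hasDerivAt_ang L u)
  exact h.deriv

/-- The derivative of `A` at `u1` is negative (there `A = L cos ∘ ang` with `sin (ang u1) > 0`).
[folklore] -/
theorem deriv_A_u1_neg (hL : 0 < L) : deriv (A L) (u1 L) < 0 := by
  have hub : u1 L ∈ Ioo (ub L) (-ub L) := ⟨ub_lt_u1 hL, by linarith [u1_neg hL, ub_neg hL]⟩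
  rw [(A_eventuallyEq_cos hL hub).deriv_eq]
  have h : HasDerivAt (fun v ↦ L * cos (ang L v)) (L * (-sin (ang L (u1 L)) * kAng L)) (u1 L) :=
    ((hasDerivAt_cos _).comp (u1 L) (hasDerivAt_ang L (u1 L))).const_mul L
  rw [h.deriv]
  have hs : 0 < sin (ang L (u1 L)) := by
    have := one_half_lt_sin_ang hL ⟨((ua_lt_ub hL).trans (ub_lt_u1 hL)).le, (u1_lt_sStar hL).le⟩
    linarith
  have := kAng_pos hL
  nlinarith [mul_pos hs this]

/-- **Regularity of the stages at parameters `u ≤ 0`.** [folklore] -/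
theorem deriv_mush_ne_zero_of_nonpos (hL : 0 < L) (τ : ℝ) {u : ℝ} (hu : u ≤ 0) :
    deriv (mush L τ) u ≠ 0 := by
  rw [deriv_mush, Ne, pt2_eq_zero_iff, not_and_or]
  by_cases hua : u < ua L
  · left; rw [deriv_absc_of_lt_ua hL τ hua]; exact one_ne_zero
  push Not at hua
  have hu3 : -(3 * L / 4) < u := (neg_three_quarters_lt_ua hL).trans_le hua
  by_cases h1 : β₁ τ = 0
  · left; rw [deriv_absc, β₂_eq_zero_of_β₁_eq_zero h1]; norm_num
  rcases eq_or_lt_of_le hu with rfl | hu0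
  · left; exact (deriv_absc_zero_pos hL τ).ne'
  by_cases h3 : β₃ τ < 1
  · right; exact (deriv_dep_pos hL h1 h3 ⟨hu3, hu0⟩).ne'
  have h3' : β₃ τ = 1 := le_antisymm (β₃_mem τ).2 (le_of_not_gt h3)
  rw [show absc L τ = absc L 1 by funext v; simpa using congrArg (fun g ↦ g v 0) (mush_of_β₃_eq_one h3' L),
    show dep L τ = dep L 1 by funext v; simpa using congrArg (fun g ↦ g v 1) (mush_of_β₃_eq_one h3' L)]
  rcases lt_trichotomy u (u1 L) with hlt | heq | hgt
  · right
    rw [deriv_dep, β₁_one, β₃_one]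
    have := deriv_Fst_pos hL ⟨hu3, hlt⟩
    simpa using this.ne'
  · left
    rw [deriv_absc, β₂_one, heq]
    have := deriv_A_u1_neg hL
    simpa using this.ne
  · -- beyond `u1`: the D-loop
    have hm : u ∈ Ioo (u1 L) (-u1 L) := ⟨hgt, by linarith [u1_neg hL]⟩
    have h := deriv_mush_one_of_mem hL hm
    rw [deriv_mush] at h
    have hne : kAng L • deriv (dloop L 1) (ang L u) ≠ 0 :=
      smul_ne_zero (kAng_pos hL).ne' (deriv_dloop_ne_zero hL 1 _)
    rw [← h, Ne, pt2_eq_zero_iff, not_and_or] at hne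
    exact hne

/-- **Each stage of the mushroom family is a regular curve.** [folklore] -/
theorem deriv_mush_ne_zero (hL : 0 < L) (τ u : ℝ) : deriv (mush L τ) u ≠ 0 := by
  rcases le_or_gt u 0 with hu | hu
  · exact deriv_mush_ne_zero_of_nonpos hL τ hu
  · have h := deriv_mush_ne_zero_of_nonpos hL τ (by linarith : -u ≤ 0)
    rw [deriv_mush, deriv_absc_neg, deriv_dep_neg, Ne, pt2_eq_zero_iff] at h
    rw [deriv_mush, Ne, pt2_eq_zero_iff]
    rintro ⟨h1, h2⟩; exact h ⟨h1, by rw [h2, neg_zero]⟩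


/-! #### The D-loop relative to the band square

The band square (with its collar) occupies `|s| < 3L/4`, `-L/4 < d < 5L/4` in the plane. -/

/-- **The far part of the D-loop misses the band square**: for angles `φ ∈ [φ_L, 3π - φ_L]` (from
the lower left corner the long way round to the lower right corner) the point `dloop L 1 φ` does not
lie in the open region `{|s| < 3L/4, d < 5L/4}`. [folklore] -/
theorem dloop_one_not_mem_square (hL : 0 < L) {φ : ℝ} (hφ : φ ∈ Icc phiL (3 * π - phiL)) :
    ¬(|L * cos φ| < 3 * L / 4 ∧ dloop L 1 φ 1 < 5 * L / 4) := by
  rintro ⟨h1, h2⟩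
  rw [abs_mul, abs_of_pos hL] at h1
  have h1' : |cos φ| < 3 / 4 := by nlinarith
  rcases le_or_gt φ π with hφπ | hφπ
  · -- `φ ∈ [φ_L, π]`: `cos φ ≤ cos φ_L = -3/4`
    have : cos φ ≤ cos phiL :=
      cos_le_cos_of_nonneg_of_le_pi (by linarith [pi_div_two_lt_phiL, pi_pos]) hφπ hφ.1
    rw [cos_phiL] at this
    have := neg_abs_le (cos φ); linarith
  rcases lt_or_ge φ (2 * π) with hφ2 | hφ2
  · -- `φ ∈ (π, 2π)`: `sin φ ≤ 0`, depth `≥ 3L/2`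
    have hs : sin φ ≤ 0 := by
      have : 0 ≤ sin (φ - π) := sin_nonneg_of_nonneg_of_le_pi (by linarith) (by linarith)
      rw [sin_sub_pi] at this; linarith
    rw [show dloop L 1 φ 1 = 3 * L / 2 - L * sin φ by
      simpa using congrArg (· 1) (dloop_one_of_sin_nonpos hL hs)] at h2
    nlinarith
  · -- `φ ∈ [2π, 3π - φ_L]`: `cos φ = cos (φ - 2π) ≥ cos (π - φ_L) = 3/4`
    have : cos (π - phiL) ≤ cos (φ - 2 * π) :=
      cos_le_cos_of_nonneg_of_le_pi (by linarith) (by linarith [pi_div_two_lt_phiL, pi_pos])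
        (by linarith [hφ.2])
    rw [cos_pi_sub, cos_phiL, cos_sub_two_pi] at this
    have := le_abs_self (cos φ); linarith

/-- **A D-loop point inside the band square lies on the flat top**: if `|L cos φ| < 3L/4` and the
depth of `dloop L 1 φ` is `< 5L/4` then `sin φ > 1/2`, so `dloop L 1 φ = (L cos φ, L)`. [folklore] -/
theorem one_half_lt_sin_of_mem_square (hL : 0 < L) {φ : ℝ} (h1 : |L * cos φ| < 3 * L / 4)
    (h2 : dloop L 1 φ 1 < 5 * L / 4) : 1 / 2 < sin φ := by
  rw [abs_mul, abs_of_pos hL] at h1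
  have hc : |cos φ| < 3 / 4 := by nlinarith
  have hs : 0 < sin φ := by
    by_contra hle; push Not at hle
    rw [show dloop L 1 φ 1 = 3 * L / 2 - L * sin φ by
      simpa using congrArg (· 1) (dloop_one_of_sin_nonpos hL hle)] at h2
    nlinarith
  have hc2 : cos φ ^ 2 < 9 / 16 := by
    have := abs_lt.1 hc; nlinarith
  nlinarith [sin_sq_add_cos_sq φ]

/-- The points `(s, L)` with `|s| < 3L/4`... indeed with `|s| ≤ 3L/4`, of the right edge of the band
square lie on the D-loop: `(s, L) = dloop L 1 (arccos (s/L))`, with `sin (arccos (s/L)) > 1/2`.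
[folklore] -/
theorem dloop_one_arccos (hL : 0 < L) {s : ℝ} (hs : |s| ≤ 3 * L / 4) :
    dloop L 1 (arccos (s / L)) = pt2 s L ∧ 1 / 2 < sin (arccos (s / L)) := by
  have hsL : |s / L| ≤ 3 / 4 := by rw [abs_div, abs_of_pos hL, div_le_iff₀ hL]; linarith
  have hb := abs_le.1 hsL
  have hsin : 1 / 2 < sin (arccos (s / L)) := by
    rw [sin_arccos, lt_sqrt (by norm_num)]
    nlinarith [sq_abs (s / L), abs_nonneg (s / L)]
  refine ⟨?_, hsin⟩
  rw [dloop_one_of_half_le_sin hL hsin.le, cos_arccos (by linarith) (by linarith),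
    mul_div_cancel₀ _ hL.ne']

/-- **The final curve between the corner parameters misses the band square**: for
`u ∈ [s*, -s*]`, `mush L 1 u` is not in `{|s| < 3L/4, d < 5L/4}`. [folklore] -/
theorem mush_one_not_mem_square (hL : 0 < L) {u : ℝ} (hu : u ∈ Icc (sStar L) (-sStar L)) :
    ¬(|mush L 1 u 0| < 3 * L / 4 ∧ mush L 1 u 1 < 5 * L / 4) := by
  have hum : u ∈ Icc (u1 L) (-u1 L) :=
    ⟨(u1_lt_sStar hL).le.trans hu.1, hu.2.trans (by linarith [u1_lt_sStar hL])⟩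
  rw [mush_one_eq_dloop hL hum, dloop_apply_zero]
  refine dloop_one_not_mem_square hL ⟨?_, ?_⟩
  · rw [← ang_sStar hL]; exact (ang_le_ang hL).2 hu.1
  · have : ang L (-sStar L) = 3 * π - phiL := by
      rw [sStar, neg_neg]; exact ang_quarter hL
    rw [← this]; exact (ang_le_ang hL).2 hu.2

/-- The final curve between the left end and the corner stays in the lower-left part of the band
square: for `u ∈ (-3L/4, s*)`, `mush L 1 u = (a, d)` with `-3L/4 < a < 0` and `0 < d ≤ L`. [folklore] -/
theorem mush_one_mem_of_mem (hL : 0 < L) {u : ℝ} (hu : u ∈ Ioo (-(3 * L / 4)) (sStar L)) :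
    mush L 1 u 0 ∈ Ioo (-(3 * L / 4)) 0 ∧ mush L 1 u 1 ∈ Ioc 0 L := by
  have hu0 : u < 0 := hu.2.trans (sStar_neg hL)
  rw [mush_one]
  exact ⟨⟨neg_three_quarters_lt_A hL hu, A_neg_of_neg hL hu0⟩,
    Fst_pos hL ⟨hu.1, hu0.le⟩, Fst_le_of_le_sStar hL hu.2.le⟩

/-- Mirror image: for `u ∈ (-s*, 3L/4)`, `mush L 1 u = (a, d)` with `0 < a < 3L/4`, `0 < d ≤ L`.
[folklore] -/
theorem mush_one_mem_of_mem' (hL : 0 < L) {u : ℝ} (hu : u ∈ Ioo (-sStar L) (3 * L / 4)) :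
    mush L 1 u 0 ∈ Ioo 0 (3 * L / 4) ∧ mush L 1 u 1 ∈ Ioc 0 L := by
  have h := mush_one_mem_of_mem hL (u := -u) ⟨by linarith [hu.2], by linarith [hu.1]⟩
  rw [mush_one, pt2_apply_zero, pt2_apply_one, A_neg, Fst_neg] at h
  rw [mush_one, pt2_apply_zero, pt2_apply_one]
  exact ⟨⟨by linarith [h.1.2], by linarith [h.1.1]⟩, h.2⟩

/-- `|mush L τ u 0| ≤ L` for `|u| ≤ L`... in general `≤ max |u| L`. [folklore] -/
theorem abs_mush_apply_zero_le (hL : 0 < L) (τ u : ℝ) : |mush L τ u 0| ≤ max |u| L :=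
  abs_absc_le hL τ u

/-- `0 ≤ mush L τ u 1`. [folklore] -/
theorem mush_apply_one_nonneg (hL : 0 < L) (τ u : ℝ) : 0 ≤ mush L τ u 1 := dep_nonneg hL τ u

end Mush
end BandSumUnit

end Literature.Topology.FourManifolds
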